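import Literature.MathematicalPhysics.QuantumFieldTheory.Balaban1983to89.T4JointDressing

/-!
# `Balaban1983to89.T4MomentMayerStep` — node O3b (ii) of the uniqueness spine, Q17 (a) booking on the O3.E-ii side: THE
MOMENT-TYPE TWO-BODY MAYER STEP — the joint dressed normalisation over `Λ₁ ∪ Λ₂` versus the product, with the MIXED FIRST
MOMENT of the exponent carried EXPLICITLY and everything else SECOND ORDER in the pair smallness (cell `pub-balaban`,
T4-DAG v5 §5 row T4-O3.E-ii / §8 Q17 (a); kernel bookkeeping over `B15.BasicStep` / `T4DressedR` / `T4JointDressing`; a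
LEAF importing `T4JointDressing` only)

HONEST FRAMING (cell `pub-balaban`, T4-DAG PAGE 1).  The cell's T4 target is the existence AND uniqueness of the continuum
limit of Bałaban's unit-scale averaged loop expectations on a finite torus — a constructive-QFT statement strictly beyond
ultraviolet stability ([Balaban1989LargeFieldII] Thm 1 p. 355); it is NOT the Yang–Mills mass gap and NOT the Clay problem.
This module is kernel bookkeeping for ONE line of ONE `EST` row (T4-O3.E-ii, paper half `t4/T4-EST-O3Eii.md`): the
two-body Mayer step of `T4JointDressing` §3 — which restores the printed product over the components of one term's region
at the price of a coupling remainder `|R₁₂| ≤ |t|·δ`, `δ` = a SUP bound on the mixed second difference of the exponent — is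
redone with the FIRST MOMENT of the mixed difference kept as an explicit signed quantity `M` and the remainder bounded by
`log cosh(|t|δ) ≤ (tδ)²/2` (Hoeffding's chord) or by the SECOND MOMENT `Q` (on `|t|δ ≤ 1`).  Why the cell wants this
(T4-DAG v5 §8 Q17 (a), CELL ANALYSIS located by two blind toy engines and cited as such, never as a fact): for CO-READ pairs
of fine bonds the mixed response of the loop functional is FIRST order per level, so a sup/Taylor booking of the pair channel
summed against `L⁴` positions per level diverges like `L^{K−j}`, while its conditional MEAN vanishes at a conjugation-invariant
conditional law (kernel: `T4CoReadMoment.integral_clm_mcomm_eq_zero`, `pairMeanField_eq_zero`, pv28-g5, p181221) and its second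
moment is summable (`T4CoReadMoment.varianceLine_le`; tower arithmetic `T4PairBirth.momentRoute_summable` /
`supRoute_not_summable`, pv05-g6, p181269).  At the JOINT-FIBRE level of this module that decision reads: book the pair defect
as `t·M/(N₁N₂) + O((tδ)² ∧ t²Q/(N₁N₂))`, with `M` handed to whoever controls conditional means — and this module proves exactly
that the defect HAS this form, for ANY bounded measurable exponent `F`, by Fubini over the two Haar fibres and three real
inequalities.  It asserts NOTHING about Bałaban's operations, averagings or conditional laws; the zero / small first moment is a
HYPOTHESIS here (`hM`), discharged elsewhere or not at all.  Value = kernel bookkeeping (the exact place where a conditional-mean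
budget `m` and a sup `δ` enter the two-body step, and with which constants); NOT summit progress, NOT the cell's estimate NE1′,
NOT a proof that any co-read pair has small conditional mean, NOT the cross-pair decorrelation clause (below).

CITATION HEADER (lean-in-tree rule 2026-08-18).  This seat (pv18 lineage gen 5) re-read the RENDERS
`b2b-balaban-ref1/pages/1989-cmp122-large-field-I/1989-cmp122-large-field-I-p002-x2.png` (journal p. 176) and `-p027-x2.png`
(p. 201) of T. Bałaban, *Large field renormalization. I. The basic step of the ℝ operation*, Commun. Math. Phys. **122** (1989)
175–202 [Balaban1989LargeFieldI] (cell paper B15; PDF page = journal page − 174), and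
`…/1989-cmp122-large-field-II/1989-cmp122-large-field-II-p024-x2.png` (p. 378) of T. Bałaban, *Large field renormalization. II.
Localization, exponentiation, and bounds for the ℝ operation*, Commun. Math. Phys. **122** (1989) 355–392 [Balaban1989LargeFieldII]
(cell paper B16), as images, and quotes VERBATIM: p. 176 (0.3) "(ℝρ)(V) = Σ_Z ρ(Z″, V) ∫dV⌈_{Z′}ρ(Z, V) / ∫dV⌈_{Z′}ρ(Z″, V)",
"We will prove that the densities are positive, and the inegration [sic] domains in the integrals above are nonempty, hence the
denominators are positive, and the operation ℝ is well defined.", and "We localize them, trying to decouple components of Z′,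
i.e., we write a polymer expansion, and then we exponentiate it. Thus, we obtain the representation
Σ_{Z′⊂Z″ᶜ} ∫dV⌈_{Z′}ρ(Z′ ∪ Z″, V) / ∫dV⌈_{Z′}ρ(Z″, V) = exp Σ_X ℝ(X, V), (0.5)"; p. 201 "we write Z explicitly as a union of
components, Z = X₁ ∪ ⋯ ∪ Xₙ, and we separate the summation over the admissible Z_k, n, X₁, …, Xₙ, from the remaining
summations, which are factorized in those domains." and "The integrations in (1.99) are also factorized in those components.
This way we write the expression in (1.99) in a form similar to a polymer expansion, suggesting explicitly localization
operations and an exponentiation."; p. 378 "We use the fact that these integrations factorize in components of Z."  The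
manuscripts are quoted for CONTEXT and SHAPE only (one term = a fibre integral over the bond variables of its region, factorized
over the components when the density is a product; positivity of the undressed denominators is the printed proviso mirrored by
the hypotheses `hne₁`, `hne₂` below) — no disputed estimate of them is used anywhere.  Nothing printed is asserted: every
`theorem` is tagged [folklore] (Fubini + convexity of `exp`), every cell statement is labelled CELL ANALYSIS / HYPOTHESIS.

THE ROW AND THE QUESTION SERVED (cell texts, verbatim excerpts; CELL ANALYSIS, not facts).  T4-DAG v5 §5: "T4-O3.E-ii° | O3b |
EST | NE1 part (ii): inter-component coupling inside one unit block — joint normalisation (β) over ∪_iΛ_i or a Mayer step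
restoring ∏_i of (1.100); … — v3: = X2's obligation (A) / T4-REF-O3 V5 (iii): a Mayer PAIR class without d_k-decay between
partners; criterion sup_{X₁}Σ_{X₂}∣v₁₂∣·weights ≪ 1 per cube …" (owner pv18 lineage; kernel `T4JointDressing` v2 p180017).
§8 Q17 (a): "… as a SUP/TAYLOR bound summed against L⁴ positions per level this diverges like (L⁴θ₁)^{K−j} = L^{K−j}; as a
MOMENT / conditional-mean bound it has ZERO conditional mean under a colour-symmetric fluctuation covariance … and variance
(L⁴θ₁²)^{K−j} = L^{−2(K−j)}, summable — so NE1′'s pair terms must be booked through the conditional mean / second moment …,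
NOT through a sup bound on the co-read channel".  DIVISION OF LABOUR (journal 2026-08-18T23:45:03Z; decisions of the sibling
rows cited by reference, not re-derived): the ONE-STEP laws and constants of the co-read channel are row T4-NE1ii-BIRTH's
(`t4/T4-EST-NE1iiBirth.md`, `T4PairBirth.lean`); the zero conditional mean from conjugation invariance + equivariance and the
second-cumulant booking `0 ≤ log∫e^{−V} ≤ ∫V²` at a FIXED-EXTERIOR CONDITIONAL LAW are row T4-O3.E-iii-b-M's
(`T4CoReadMoment.lean` K9/K10, `t4/T4-EST-O3Eiiib.md` v2 §4bis); THIS module is the joint-fibre level only — the product of the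
two DRESSED fibre laws of one term, the mixed difference `R(y, z)` of `T4JointDressing` §3, its first/second moments `M`, `Q`.

DICTIONARY (as in `B15.BasicStep` / `T4DressedR` / `T4JointDressing`): a fibre `s : Finset (PBond P j)` = the bond variables
`Λ` integrated out; `V←y := Function.updateFinset V s y`; `fibreIntegral s f V = ∫dV⌈_Λ f` through `V` (= `toReal` of Mathlib's
`lmarginal` against the product of the normalised Haar measures `HaarData.haar`); `FibreIndep s f` = `f` does not depend on the
`Λ`-variables; the DRESSED densities `oldᵢ·e^{tF}` (`oldᵢ ≥ 0` bounded measurable, `old₁` `Λ₂`-independent, `old₂`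
`Λ₁`-independent — two components of ONE term; `F` bounded measurable — in the cell `F = W_C∘avgⁿ`, `T4OscSandwich.loopDressing`);
`Nᵢ := ∫dV⌈_{Λᵢ}(oldᵢe^{tF})(V)`, `N₁₂ := ∫dV⌈_{Λ₁∪Λ₂}(old₁old₂e^{tF})(V)`; the MIXED SECOND DIFFERENCE
`R(y, z) := F(V←y←z) − F(V←y) − F(V←z) + F(V)` (`mixedDiff`); the dressed fibre WEIGHTS `a(y) := old₁(V←y)e^{tF(V←y)}`,
`b(z) := old₂(V←z)e^{tF(V←z)}` (`dressedWeight`; `∫a = N₁`, `∫b = N₂` by the bridge of §2); the MIXED FIRST MOMENT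
`M := ∫∫ a(y)b(z)R(y, z) dy dz` (`mixedMoment`, Bochner over the product Haar fibre `haarFibre Λ₁ ⊗ haarFibre Λ₂`) and SECOND
MOMENT `Q := ∫∫ a b R²` (`mixedSecondMoment`); so `M/(N₁N₂)` (`Q/(N₁N₂)`) is the mean of `R` (`R²`) under the PRODUCT of the two
dressed conditional fibre laws through `V`.  The key pointwise identity (from `FibreIndep` + `updateFinset_updateFinset_comm`):
`e^{tF(V)}·old₁old₂e^{tF}(V←y←z) = a(y)·b(z)·e^{tR(y,z)}` — so `e^{tF(V)}N₁₂ = ∫∫ a b e^{tR}` is an exponential moment of `X = tR`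
against the weight `ρ = a ⊗ b`, and the whole module is the elementary sandwich of such a moment between its first-order
Taylor polynomial and Hoeffding's chord.

WHAT IS PROVED (all [folklore]; `lean check` rc 0, 0 sorry, 0 warnings; standard axioms).
§0 `exp_le_cosh_add_mul_sinh_div` (`|x| ≤ s ⇒ eˣ ≤ cosh s + x·sinh s/s`, convexity of `exp`, Mathlib `convexOn_exp`),
`one_add_le_exp`, `log_cosh_le_half_sq` (Mathlib `Real.cosh_le_exp_half_sq`), `log_cosh_nonneg`, `sinh_div_nonneg`.
§1 ABSTRACT, on a finite measure space with a bounded measurable weight `0 ≤ ρ ≤ C` and a measurable exponent `X` with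
`|X| ≤ s` WHERE `ρ ≠ 0`: `weighted_bounds`, `weighted_integrable`, `weighted_exp_sandwich` (`∫ρ + ∫ρX ≤ ∫ρeˣ ≤ cosh s·∫ρ + (sinh s/s)·∫ρX`), `weighted_exp_second_moment`
(`s ≤ 1`: `∫ρ + ∫ρX − ∫ρX² ≤ ∫ρeˣ ≤ ∫ρ + ∫ρX + ∫ρX²`, Mathlib `Real.abs_exp_sub_one_sub_id_le`), `weighted_exp_ratio_bounds`
(`|∫ρX| ≤ m∫ρ ⇒ (1 − m)∫ρ ≤ ∫ρeˣ ≤ (cosh s + m·sinh s/s)∫ρ`), `integral_eq_zero_of_antisymm` (`σ` measure-preserving, `h∘σ = −h`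
⇒ `∫h = 0`).
§2 BRIDGES: `fibreIntegral_eq_integral` (`∫dV⌈_Λ f(V) = ∫ f(V←y) dhaarFibre`, Bochner, for measurable `f ≥ 0`),
`measurable_updateFinset_pair`, `fibreIntegral_union_eq_integral_prod` (disjoint `Λ₁, Λ₂`: `∫dV⌈_{Λ₁∪Λ₂} g(V) = ∫ g(V←y←z)
d(haarFibre Λ₁ ⊗ haarFibre Λ₂)`, Mathlib `lmarginal_union` + `lintegral_prod`).
§3 THE STEP (hypotheses of `T4JointDressing.fibreIntegral_union_exp_sandwich` verbatim: `hd hm₁ hm₂ hF h0₁ h0₂ hC₁ hC₂ hI₁ hI₂ hFB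
t δ V hmix`, `hmix` = `|R(y, z)| ≤ δ` whenever `old₁(V←y) ≠ 0 ≠ old₂(V←z)`): `moment_data` (the identifications `∫ρ = N₁N₂`,
`∫ρX = t·M`, `∫ρX² = t²·Q`, `∫ρeˣ = e^{tF(V)}N₁₂` and the §1 hypotheses with `s = |t|δ`);
(A) `fibreIntegral_union_exp_moment_sandwich`: `N₁N₂ + t·M ≤ e^{tF(V)}N₁₂ ≤ cosh(|t|δ)·N₁N₂ + (sinh(|t|δ)/(|t|δ))·t·M`;
(C) `fibreIntegral_union_exp_second_moment` (`|t|δ ≤ 1`): `N₁N₂ + tM − t²Q ≤ e^{tF(V)}N₁₂ ≤ N₁N₂ + tM + t²Q`;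
(B′) `fibreIntegral_union_exp_ratio_bounds` (`|M| ≤ m·N₁N₂`): `(1 − |t|m)N₁N₂ ≤ e^{tF(V)}N₁₂ ≤ (cosh(|t|δ) + m·sinh(|t|δ)/δ)N₁N₂`,
and `log_coupling_bounds_of_budget` (`|t|m < 1`, undressed integrals `≠ 0`): `log(1 − |t|m) ≤ log N₁₂ − log N₁ − log N₂ + tF(V)
≤ log(cosh(|t|δ) + m·sinh(|t|δ)/δ)`;
(B) `fibreIntegral_union_exp_sandwich_of_moment_zero`, `log_coupling_bounds_of_moment_zero` (`M = 0`: `0 ≤ log N₁₂ − log N₁ −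
log N₂ + tF(V) ≤ log cosh(|t|δ)`), `defect_union_sub_bounds_of_moment_zero` (the same for the dressing defects `D_Λ =
log(∫⌈_Λ(old e^{tF})/∫⌈_Λ old) − tF(V)` of node O3b (i), using the printed factorisation `T4JointDressing.fibreIntegral_union_mul_eq`
of the UNDRESSED joint integral: `0 ≤ D_{Λ₁∪Λ₂} − D_{Λ₁} − D_{Λ₂} ≤ log cosh(|t|δ)`), `log_cosh_abs_mul_le` (`≤ t²δ²/2`) — compare
`T4JointDressing.abs_defect_union_sub_le`: `|…| ≤ |t|δ`;
(D) `abs_mixedMoment_le_of_antisymm` — a STRUCTURAL sufficient condition for the budget (HYPOTHESIS SHAPE, NOT PRINTED and NOT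
the cell's mechanism, which lives one level up at the conditional law of the fluctuation field, `T4CoReadMoment` K9): if a
Haar-fibre-preserving map `σ` of the `Λ₂`-variables fixes `old₂(V←·)` and `F(V←·)` and `R = R₁ + R₂` on the supports with
`R₁(y, σz) = −R₁(y, z)` and `|R₂| ≤ m`, then `|M| ≤ m·N₁N₂` (the odd part drops out: Fubini + `integral_eq_zero_of_antisymm`).
§4 LOOP CONSUMERS under the separated pair shape `T4JointDressing.LoopPairOscBoundSep av dom C₂ θ₁ θₓ` (HYPOTHESIS SHAPE, NOT
PRINTED): `loopDressing_mixed_le_sep` (the shape + supports in `dom` + `V ∈ dom j` give `hmix` for `F = W_C∘avgⁿ` with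
`δ = C₂·|w|·|Λ₁|·|Λ₂|·θ₁ⁿ·θₓ^{n′}` — the discharge used inline by `T4JointDressing.fibreIntegral_union_loopDressing_sandwich_sep`,
now a named lemma), `fibreIntegral_union_loopDressing_moment_sandwich_sep` ((A) for the loop dressing),
`fibreIntegral_union_loopDressing_ratio_bounds_sep` ((B′) for the loop dressing).

READING FOR THE CELL [analysis, not kernel].  (1) With a sup `δ` alone the two-body defect is `±|t|δ` (first order,
`T4JointDressing`); with a conditional-mean budget `|M| ≤ m·N₁N₂` it is confined to `[log(1 − |t|m), log(cosh(|t|δ) + m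
sinh(|t|δ)/δ)]`, i.e. `O(|t|m) + O((tδ)²)`: FIRST order only through the MEAN, second order through the sup — the joint-fibre
form of Q17 (a)'s booking.  (2) The mean that matters is the mean of `R` under the product of the two DRESSED conditional fibre
laws through the CURRENT exterior `V` (weights `a`, `b` include `e^{tF}`); a zero-mean statement at the UNDRESSED or flat law
leaves a budget `m` of the size of (dressing × deviation) corrections — exactly the "one more deviation factor" of
`t4/T4-EST-O3Eiiib.md` v2 (M1)/O-G7; this module does not estimate it.  (3) (C) needs no centring and no normalisation: it is
the un-normalised two-fibre twin of `T4CoReadMoment.log_integral_exp_neg_le_sq` (K10), with the first moment explicit instead of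
assumed zero.  (4) Many pairs: the module treats ONE pair `(Λ₁, Λ₂)`; iterating it over the components of one term's region, or
summing pair defects inside a cube budget, needs the variance of a SUM of pair pieces — the cross-pair DECORRELATION clause
located as O-G8 of `t4/T4-EST-O3Eiiib.md` v2 (GAPS G-pv28g5-2), owned by row O3.E-ii as a HYPOTHESIS of NE1′ and NOT typed here.

LOCATED ITEMS NOT TOUCHED (cell obligations, none printed, none kernel): the pair shape `LoopPairOscBoundSep` itself (NE1a (ii) /
row NE1ii-BIRTH: first order for co-read pairs, product law for far pairs — Q17 (b)); any instance of the budget `m` for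
Bałaban's conditional laws (rows O3.E-iii-b-M K9 at flat, O-G7 off flat); the cross-pair decorrelation O-G8; the multi-step
(inductive) polymer format of the full expansion (rows O3.E-iii-a, O3.E-iii-b, O3.E-iii-c); `s`-body couplings for `s ≥ 3` (`T4MixedOscShape`).
-/

open scoped BigOperators ENNReal
open _root_.MeasureTheory Function Finset

namespace Literature.MathematicalPhysics.QuantumFieldTheory.Balaban1983to89.T4MomentMayerStep

open B15.BasicStep T4DressedR T4Continuum T4AvgSensitivity T4OscSandwich T4JointDressing

/-! ## §0 Real inequalities: the tangent and the HOEFFDING CHORD of `exp` on `[-s, s]`; `log cosh s ≤ s²/2` -/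

/-- HOEFFDING'S CHORD BOUND: on `|x| ≤ s` the convex function `exp` lies below its chord through `(±s, e^{±s})`:
`eˣ ≤ cosh s + x·(sinh s / s)` (at `s = 0` both sides are `1`, with Lean's `0/0 = 0`). [folklore] -/
theorem exp_le_cosh_add_mul_sinh_div {x s : ℝ} (h : |x| ≤ s) :
    Real.exp x ≤ Real.cosh s + x * (Real.sinh s / s) := by
  have hs0 : 0 ≤ s := (abs_nonneg x).trans h
  rcases hs0.eq_or_lt with hs | hs
  · -- `s = 0`, hence `x = 0`
    have hx : x = 0 := abs_nonpos_iff.mp (h.trans_eq hs.symm)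
    subst hx; rw [← hs]; simp
  · have hxs := abs_le.mp h
    set a : ℝ := (s - x) / (2 * s) with ha
    set b : ℝ := (s + x) / (2 * s) with hb
    have ha0 : 0 ≤ a := div_nonneg (by linarith [hxs.2]) (by linarith)
    have hb0 : 0 ≤ b := div_nonneg (by linarith [hxs.1]) (by linarith)
    have hab : a + b = 1 := by rw [ha, hb]; field_simp; ring
    have hx : a • (-s) + b • s = x := by simp only [smul_eq_mul]; rw [ha, hb]; field_simp; ring
    have key := convexOn_exp.2 (Set.mem_univ (-s)) (Set.mem_univ s) ha0 hb0 hab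
    rw [hx] at key
    refine key.trans (le_of_eq ?_)
    simp only [smul_eq_mul]
    rw [ha, hb, Real.cosh_eq, Real.sinh_eq]
    field_simp
    ring

/-- The tangent at `0`: `1 + x ≤ eˣ`. [folklore] -/
theorem one_add_le_exp (x : ℝ) : 1 + x ≤ Real.exp x := by
  have := Real.add_one_le_exp x; linarith

/-- `log cosh s ≤ s²/2` (from Mathlib's `cosh s ≤ exp (s²/2)`). [folklore] -/
theorem log_cosh_le_half_sq (s : ℝ) : Real.log (Real.cosh s) ≤ s ^ 2 / 2 := by
  have h := Real.log_le_log (Real.cosh_pos s) (Real.cosh_le_exp_half_sq s)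
  rwa [Real.log_exp] at h

/-- `0 ≤ log cosh s`. [folklore] -/
theorem log_cosh_nonneg (s : ℝ) : 0 ≤ Real.log (Real.cosh s) :=
  Real.log_nonneg (Real.one_le_cosh s)

/-- `0 ≤ sinh s / s`. [folklore] -/
theorem sinh_div_nonneg (s : ℝ) : 0 ≤ Real.sinh s / s := by
  rcases le_or_gt 0 s with hs | hs
  · exact div_nonneg (Real.sinh_nonneg_iff.mpr hs) hs
  · exact div_nonneg_of_nonpos (by have := Real.sinh_nonneg_iff.not.mpr (not_le.mpr hs); linarith [Real.sinh_neg s, Real.sinh_nonneg_iff.mpr (neg_nonneg.mpr hs.le)]) hs.le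

/-! ## §1 ABSTRACT WEIGHTED EXPONENTIAL-MOMENT SANDWICH on a finite measure space

`ρ ≥ 0` a bounded measurable weight, `X` a measurable exponent with `|X| ≤ s` wherever `ρ ≠ 0`;
`N = ∫ρ`, `M = ∫ρX` (first moment), `P = ∫ρe^X`, `Q = ∫ρX²` (second moment). -/

section Abstract

variable {Ω : Type*} [MeasurableSpace Ω] {μ : Measure Ω} [IsFiniteMeasure μ]

omit [MeasurableSpace Ω] in
/-- Bounds for the four weighted integrands. [folklore] -/
theorem weighted_bounds {ρ X : Ω → ℝ} (hρ0 : ∀ ω, 0 ≤ ρ ω) {C : ℝ} (hρC : ∀ ω, ρ ω ≤ C) {s : ℝ}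
    (hX : ∀ ω, ρ ω ≠ 0 → |X ω| ≤ s) (ω : Ω) :
    |ρ ω| ≤ C ∧ |ρ ω * X ω| ≤ C * |s| ∧ |ρ ω * Real.exp (X ω)| ≤ C * Real.exp |s| ∧
      |ρ ω * X ω ^ 2| ≤ C * s ^ 2 := by
  have hC0 : 0 ≤ C := (hρ0 ω).trans (hρC ω)
  refine ⟨by rw [abs_of_nonneg (hρ0 ω)]; exact hρC ω, ?_, ?_, ?_⟩
  all_goals by_cases hz : ρ ω = 0
  · rw [hz]; simp; positivity
  · rw [abs_mul, abs_of_nonneg (hρ0 ω)]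
    exact mul_le_mul (hρC ω) ((hX ω hz).trans (le_abs_self s)) (abs_nonneg _) hC0
  · rw [hz]; simp; positivity
  · rw [abs_mul, abs_of_nonneg (hρ0 ω), abs_of_pos (Real.exp_pos _)]
    refine mul_le_mul (hρC ω) ?_ (Real.exp_pos _).le hC0
    exact Real.exp_le_exp.mpr ((le_abs_self _).trans ((hX ω hz).trans (le_abs_self s)))
  · rw [hz]; simp; positivity
  · rw [abs_mul, abs_of_nonneg (hρ0 ω), abs_of_nonneg (sq_nonneg _)]
    refine mul_le_mul (hρC ω) ?_ (sq_nonneg _) hC0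
    have h1 := hX ω hz
    rw [← sq_abs]; rw [← sq_abs s]
    exact pow_le_pow_left₀ (abs_nonneg _) (h1.trans (le_abs_self s)) 2

/-- Integrability of the four weighted integrands (bounded measurable on a finite measure space). [folklore] -/
theorem weighted_integrable {ρ X : Ω → ℝ} (hρm : Measurable ρ) (hXm : Measurable X) (hρ0 : ∀ ω, 0 ≤ ρ ω)
    {C : ℝ} (hρC : ∀ ω, ρ ω ≤ C) {s : ℝ} (hX : ∀ ω, ρ ω ≠ 0 → |X ω| ≤ s) :
    Integrable ρ μ ∧ Integrable (fun ω => ρ ω * X ω) μ ∧ Integrable (fun ω => ρ ω * Real.exp (X ω)) μ ∧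
      Integrable (fun ω => ρ ω * X ω ^ 2) μ := by
  have hb := weighted_bounds hρ0 hρC hX
  have key : ∀ {f : Ω → ℝ}, Measurable f → ∀ {K : ℝ}, (∀ ω, |f ω| ≤ K) → Integrable f μ := fun hf K hK =>
    (integrable_const K).mono' hf.aestronglyMeasurable (ae_of_all _ fun ω => by rw [Real.norm_eq_abs]; exact hK ω)
  exact ⟨key hρm fun ω => (hb ω).1, key (hρm.mul hXm) fun ω => (hb ω).2.1,
    key (hρm.mul (Real.measurable_exp.comp hXm)) fun ω => (hb ω).2.2.1,
    key (hρm.mul (hXm.pow_const 2)) fun ω => (hb ω).2.2.2⟩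

/-- THE WEIGHTED EXPONENTIAL-MOMENT SANDWICH (tangent below, Hoeffding chord above):
`N + M ≤ P ≤ cosh s · N + (sinh s / s) · M`. [folklore] -/
theorem weighted_exp_sandwich {ρ X : Ω → ℝ} (hρm : Measurable ρ) (hXm : Measurable X) (hρ0 : ∀ ω, 0 ≤ ρ ω)
    {C : ℝ} (hρC : ∀ ω, ρ ω ≤ C) {s : ℝ} (hX : ∀ ω, ρ ω ≠ 0 → |X ω| ≤ s) :
    ∫ ω, ρ ω ∂μ + ∫ ω, ρ ω * X ω ∂μ ≤ ∫ ω, ρ ω * Real.exp (X ω) ∂μ ∧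
    ∫ ω, ρ ω * Real.exp (X ω) ∂μ
      ≤ Real.cosh s * ∫ ω, ρ ω ∂μ + (Real.sinh s / s) * ∫ ω, ρ ω * X ω ∂μ := by
  obtain ⟨hi₀, hi₁, hi₂, -⟩ := weighted_integrable (μ := μ) hρm hXm hρ0 hρC hX
  constructor
  · rw [← integral_add hi₀ hi₁]
    refine integral_mono (hi₀.add hi₁) hi₂ (fun ω => ?_)
    show ρ ω + ρ ω * X ω ≤ ρ ω * Real.exp (X ω)
    have h1 := one_add_le_exp (X ω)
    nlinarith [hρ0 ω]
  · rw [← integral_const_mul, ← integral_const_mul, ← integral_add (hi₀.const_mul _) (hi₁.const_mul _)]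
    refine integral_mono hi₂ ((hi₀.const_mul _).add (hi₁.const_mul _)) (fun ω => ?_)
    show ρ ω * Real.exp (X ω) ≤ Real.cosh s * ρ ω + (Real.sinh s / s) * (ρ ω * X ω)
    by_cases hz : ρ ω = 0
    · rw [hz]; simp
    · have h1 := exp_le_cosh_add_mul_sinh_div (hX ω hz)
      have h2 := mul_le_mul_of_nonneg_left h1 (hρ0 ω)
      linarith [h2]

/-- THE SECOND-MOMENT FORM (for `s ≤ 1`, Mathlib's `|eˣ − 1 − x| ≤ x²` on `|x| ≤ 1`):
`P ≤ N + M + Q` and `N + M − Q ≤ P`. [folklore] -/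
theorem weighted_exp_second_moment {ρ X : Ω → ℝ} (hρm : Measurable ρ) (hXm : Measurable X) (hρ0 : ∀ ω, 0 ≤ ρ ω)
    {C : ℝ} (hρC : ∀ ω, ρ ω ≤ C) {s : ℝ} (hX : ∀ ω, ρ ω ≠ 0 → |X ω| ≤ s) (hs : s ≤ 1) :
    ∫ ω, ρ ω * Real.exp (X ω) ∂μ ≤ ∫ ω, ρ ω ∂μ + ∫ ω, ρ ω * X ω ∂μ + ∫ ω, ρ ω * X ω ^ 2 ∂μ ∧
    ∫ ω, ρ ω ∂μ + ∫ ω, ρ ω * X ω ∂μ - ∫ ω, ρ ω * X ω ^ 2 ∂μ ≤ ∫ ω, ρ ω * Real.exp (X ω) ∂μ := by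
  obtain ⟨hi₀, hi₁, hi₂, hi₃⟩ := weighted_integrable (μ := μ) hρm hXm hρ0 hρC hX
  have hi₀₁ : Integrable (fun ω => ρ ω + ρ ω * X ω) μ := hi₀.add hi₁
  have hpt : ∀ ω, |ρ ω * Real.exp (X ω) - ρ ω - ρ ω * X ω| ≤ ρ ω * X ω ^ 2 := by
    intro ω
    by_cases hz : ρ ω = 0
    · rw [hz]; simp
    · have h1 := Real.abs_exp_sub_one_sub_id_le ((hX ω hz).trans hs)
      have e : ρ ω * Real.exp (X ω) - ρ ω - ρ ω * X ω = ρ ω * (Real.exp (X ω) - 1 - X ω) := by ring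
      rw [e, abs_mul, abs_of_nonneg (hρ0 ω)]
      exact mul_le_mul_of_nonneg_left h1 (hρ0 ω)
  constructor
  · rw [← integral_add hi₀ hi₁, ← integral_add hi₀₁ hi₃]
    refine integral_mono hi₂ (hi₀₁.add hi₃) (fun ω => ?_)
    show ρ ω * Real.exp (X ω) ≤ ρ ω + ρ ω * X ω + ρ ω * X ω ^ 2
    have := (abs_le.mp (hpt ω)).2; linarith
  · rw [← integral_add hi₀ hi₁, ← integral_sub hi₀₁ hi₃]
    refine integral_mono (hi₀₁.sub hi₃) hi₂ (fun ω => ?_)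
    show ρ ω + ρ ω * X ω - ρ ω * X ω ^ 2 ≤ ρ ω * Real.exp (X ω)
    have := (abs_le.mp (hpt ω)).1; linarith

/-- FIRST-MOMENT BUDGET ⇒ RATIO BOUNDS: if `|M| ≤ m·N` then `(1 − m)·N ≤ P ≤ (cosh s + m·(sinh s / s))·N`. [folklore] -/
theorem weighted_exp_ratio_bounds {ρ X : Ω → ℝ} (hρm : Measurable ρ) (hXm : Measurable X) (hρ0 : ∀ ω, 0 ≤ ρ ω)
    {C : ℝ} (hρC : ∀ ω, ρ ω ≤ C) {s : ℝ} (hX : ∀ ω, ρ ω ≠ 0 → |X ω| ≤ s) {m : ℝ}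
    (hM : |∫ ω, ρ ω * X ω ∂μ| ≤ m * ∫ ω, ρ ω ∂μ) :
    (1 - m) * ∫ ω, ρ ω ∂μ ≤ ∫ ω, ρ ω * Real.exp (X ω) ∂μ ∧
    ∫ ω, ρ ω * Real.exp (X ω) ∂μ ≤ (Real.cosh s + m * (Real.sinh s / s)) * ∫ ω, ρ ω ∂μ := by
  have h := weighted_exp_sandwich (μ := μ) hρm hXm hρ0 hρC hX
  have hM' := abs_le.mp hM
  constructor
  · nlinarith [h.1, hM'.1]
  · have h3 : (Real.sinh s / s) * ∫ ω, ρ ω * X ω ∂μ ≤ (Real.sinh s / s) * (m * ∫ ω, ρ ω ∂μ) :=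
      mul_le_mul_of_nonneg_left hM'.2 (sinh_div_nonneg s)
    nlinarith [h.2, h3]

omit [IsFiniteMeasure μ] in
/-- ODD INTEGRANDS VANISH: if `σ` preserves `μ` and `h ∘ σ = −h` then `∫ h dμ = 0`. [folklore] -/
theorem integral_eq_zero_of_antisymm {σ : Ω → Ω} (hσ : MeasurePreserving σ μ μ) {h : Ω → ℝ}
    (hm : Measurable h) (hodd : ∀ ω, h (σ ω) = -h ω) : ∫ ω, h ω ∂μ = 0 := by
  have h1 : ∫ ω, h (σ ω) ∂μ = ∫ ω, h ω ∂μ := by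
    have := integral_map (μ := μ) hσ.measurable.aemeasurable (f := h) hm.aestronglyMeasurable
    rw [hσ.map_eq] at this
    exact this.symm
  have h2 : ∫ ω, h (σ ω) ∂μ = -∫ ω, h ω ∂μ := by
    rw [← integral_neg]; exact integral_congr_ae (ae_of_all _ hodd)
  linarith

end Abstract

/-! ## §2 BRIDGES: the tree's fibre integrals (`B15.BasicStep.fibreIntegral` = `toReal ∘ lmarginal`) as Bochner integrals
over the Haar fibre, and over the PRODUCT of the two Haar fibres of a disjoint union (Fubini) -/

/-- The HAAR FIBRE MEASURE over the bond variables `b ∈ s` (= `Λ`): the finite product of the normalised Haar measures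
(the measure against which `fibreIntegral s` integrates, `B15.BasicStep`). [folklore] -/
noncomputable abbrev haarFibre (G : Type*) [GaugeGroup G] [MeasurableSpace G] [HaarData G] {P : Params} {j : ℕ}
    (s : Finset (PBond P j)) : Measure (s → G) :=
  Measure.pi fun _ : s => (HaarData.haar : Measure G)

section SetupLevel

variable {P : Params} {j : ℕ} {G : Type*} [GaugeGroup G] [MeasurableSpace G] [HaarData G]
variable [DecidableEq (PBond P j)]

/-- SINGLE-FIBRE BRIDGE: for a measurable non-negative density, `∫dV⌈_Λ f (V) = ∫ f(V←y) dhaarFibre(y)` (Bochner).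
[folklore] -/
theorem fibreIntegral_eq_integral (s : Finset (PBond P j)) {f : Density P j G} (hf : Measurable f)
    (h0 : ∀ U, 0 ≤ f U) (V : GaugeField P j G) :
    fibreIntegral s f V = ∫ y, f (updateFinset V s y) ∂haarFibre G s := by
  have h := integral_eq_lintegral_of_nonneg_ae (μ := haarFibre G s)
    (Filter.Eventually.of_forall fun y => h0 (updateFinset V s y))
    ((hf.comp measurable_updateFinset).aestronglyMeasurable)
  rw [h]
  rfl

omit [GaugeGroup G] [HaarData G] in
/-- The two-step coordinate update `(y, z) ↦ V←y←z` is jointly measurable. [folklore] -/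
theorem measurable_updateFinset_pair (V : GaugeField P j G) (s₁ s₂ : Finset (PBond P j)) :
    Measurable (fun p : (s₁ → G) × (s₂ → G) => updateFinset (updateFinset V s₁ p.1) s₂ p.2) :=
  measurable_updateFinset'.comp ((measurable_updateFinset.comp measurable_fst).prodMk measurable_snd)

/-- JOINT-FIBRE BRIDGE (Fubini, Mathlib `lmarginal_union` + `lintegral_prod`): for a measurable density `0 ≤ g ≤ C` and
disjoint `Λ₁, Λ₂`, `∫dV⌈_{Λ₁∪Λ₂} g (V) = ∫ g(V←y←z) d(haarFibre Λ₁ ⊗ haarFibre Λ₂)(y, z)` (Bochner over the product).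
[folklore] -/
theorem fibreIntegral_union_eq_integral_prod {s₁ s₂ : Finset (PBond P j)} (hd : Disjoint s₁ s₂) {g : Density P j G}
    (hg : Measurable g) (h0 : ∀ U, 0 ≤ g U) (V : GaugeField P j G) :
    fibreIntegral (s₁ ∪ s₂) g V
      = ∫ p, g (updateFinset (updateFinset V s₁ p.1) s₂ p.2) ∂(haarFibre G s₁).prod (haarFibre G s₂) := by
  have hmeas : Measurable (fun p : (s₁ → G) × (s₂ → G) => g (updateFinset (updateFinset V s₁ p.1) s₂ p.2)) :=
    hg.comp (measurable_updateFinset_pair V s₁ s₂)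
  have hu := congrFun (lmarginal_union (fun _ : PBond P j => (HaarData.haar : Measure G))
    (fun U => ENNReal.ofReal (g U)) (ofReal_comp_measurable hg) hd) V
  have h1 : fibreIntegral (s₁ ∪ s₂) g V = (∫⁻ y, ∫⁻ z, ENNReal.ofReal (g (updateFinset (updateFinset V s₁ y) s₂ z))
      ∂haarFibre G s₂ ∂haarFibre G s₁).toReal := by
    simp only [fibreIntegral]; rw [hu]; rfl
  have h2 : ∫⁻ p, ENNReal.ofReal (g (updateFinset (updateFinset V s₁ p.1) s₂ p.2)) ∂(haarFibre G s₁).prod (haarFibre G s₂)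
      = ∫⁻ y, ∫⁻ z, ENNReal.ofReal (g (updateFinset (updateFinset V s₁ y) s₂ z)) ∂haarFibre G s₂ ∂haarFibre G s₁ :=
    lintegral_prod _ (ENNReal.measurable_ofReal.comp hmeas).aemeasurable
  have h3 : ∫ p, g (updateFinset (updateFinset V s₁ p.1) s₂ p.2) ∂(haarFibre G s₁).prod (haarFibre G s₂)
      = (∫⁻ p, ENNReal.ofReal (g (updateFinset (updateFinset V s₁ p.1) s₂ p.2))
          ∂(haarFibre G s₁).prod (haarFibre G s₂)).toReal :=
    integral_eq_lintegral_of_nonneg_ae (Filter.Eventually.of_forall fun p => h0 _) hmeas.aestronglyMeasurable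
  rw [h1, h3, h2]

/-! ## §3 THE MOMENT-TYPE TWO-BODY MAYER STEP over two disjoint fibres of one term -/

omit [MeasurableSpace G] [HaarData G] in
/-- THE MIXED SECOND DIFFERENCE of the exponent `F` across the two fibres through `V`, in iterated coordinates:
`R(y, z) = F(V←y←z) − F(V←y) − F(V←z) + F(V)` (the quantity bounded by `δ` in `T4JointDressing` §3). [folklore] -/
def mixedDiff (F : Density P j G) (s₁ s₂ : Finset (PBond P j)) (V : GaugeField P j G)
    (y : s₁ → G) (z : s₂ → G) : ℝ :=
  F (updateFinset (updateFinset V s₁ y) s₂ z) - F (updateFinset V s₁ y) - F (updateFinset V s₂ z) + F V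

omit [MeasurableSpace G] [HaarData G] in
/-- THE DRESSED FIBRE WEIGHT `a(y) = old(V←y)·e^{tF(V←y)}` (so that `∫ a dhaarFibre = ∫dV⌈_Λ(old·e^{tF})(V) = N_Λ`).
[folklore] -/
noncomputable def dressedWeight (old F : Density P j G) (t : ℝ) (s : Finset (PBond P j))
    (V : GaugeField P j G) (y : s → G) : ℝ :=
  old (updateFinset V s y) * Real.exp (t * F (updateFinset V s y))

/-- THE MIXED FIRST MOMENT `M = ∫∫ a(y) b(z) R(y, z)` of the mixed difference against the product of the two DRESSED fibre
weights (Bochner, product Haar fibre).  `M/(N₁N₂)` is the mean of `R` under the product of the two dressed conditional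
fibre laws. [folklore] -/
noncomputable def mixedMoment (old₁ old₂ F : Density P j G) (t : ℝ) (s₁ s₂ : Finset (PBond P j))
    (V : GaugeField P j G) : ℝ :=
  ∫ p, dressedWeight old₁ F t s₁ V p.1 * dressedWeight old₂ F t s₂ V p.2 * mixedDiff F s₁ s₂ V p.1 p.2
    ∂(haarFibre G s₁).prod (haarFibre G s₂)

/-- THE MIXED SECOND MOMENT `Q = ∫∫ a(y) b(z) R(y, z)²`. [folklore] -/
noncomputable def mixedSecondMoment (old₁ old₂ F : Density P j G) (t : ℝ) (s₁ s₂ : Finset (PBond P j))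
    (V : GaugeField P j G) : ℝ :=
  ∫ p, dressedWeight old₁ F t s₁ V p.1 * dressedWeight old₂ F t s₂ V p.2 * mixedDiff F s₁ s₂ V p.1 p.2 ^ 2
    ∂(haarFibre G s₁).prod (haarFibre G s₂)

/-- IDENTIFICATION LEMMA: the three weighted integrals of §1 for the weight `ρ = a ⊗ b` and the exponent `X = t·R` on the
product fibre are `N₁N₂`, `t·M` and `e^{tF(V)}·N₁₂`; and `ρ, X` satisfy the hypotheses of §1 with `s = |t|δ`. [folklore] -/
theorem moment_data {s₁ s₂ : Finset (PBond P j)} (hd : Disjoint s₁ s₂) {old₁ old₂ : Density P j G}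
    (F : Density P j G) (hm₁ : Measurable old₁) (hm₂ : Measurable old₂) (hF : Measurable F)
    (h0₁ : ∀ U, 0 ≤ old₁ U) (h0₂ : ∀ U, 0 ≤ old₂ U) {C : ℝ} (hC₁ : ∀ U, old₁ U ≤ C) (hC₂ : ∀ U, old₂ U ≤ C)
    (hI₁ : FibreIndep s₂ old₁) (hI₂ : FibreIndep s₁ old₂) {B : ℝ} (hFB : ∀ U, |F U| ≤ B) (t δ : ℝ) (V : GaugeField P j G)
    (hmix : ∀ (y : s₁ → G) (z : s₂ → G), old₁ (updateFinset V s₁ y) ≠ 0 → old₂ (updateFinset V s₂ z) ≠ 0 →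
      |F (updateFinset (updateFinset V s₁ y) s₂ z) - F (updateFinset V s₁ y) - F (updateFinset V s₂ z) + F V| ≤ δ) :
    let ρ : (s₁ → G) × (s₂ → G) → ℝ := fun p => dressedWeight old₁ F t s₁ V p.1 * dressedWeight old₂ F t s₂ V p.2
    let X : (s₁ → G) × (s₂ → G) → ℝ := fun p => t * mixedDiff F s₁ s₂ V p.1 p.2
    Measurable ρ ∧ Measurable X ∧ (∀ p, 0 ≤ ρ p) ∧ (∀ p, ρ p ≤ (C * Real.exp (|t| * B)) * (C * Real.exp (|t| * B))) ∧
    (∀ p, ρ p ≠ 0 → |X p| ≤ |t| * δ) ∧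
    ∫ p, ρ p ∂(haarFibre G s₁).prod (haarFibre G s₂)
      = fibreIntegral s₁ (fun U => old₁ U * Real.exp (t * F U)) V
          * fibreIntegral s₂ (fun U => old₂ U * Real.exp (t * F U)) V ∧
    ∫ p, ρ p * X p ∂(haarFibre G s₁).prod (haarFibre G s₂) = t * mixedMoment old₁ old₂ F t s₁ s₂ V ∧
    ∫ p, ρ p * X p ^ 2 ∂(haarFibre G s₁).prod (haarFibre G s₂) = t ^ 2 * mixedSecondMoment old₁ old₂ F t s₁ s₂ V ∧
    ∫ p, ρ p * Real.exp (X p) ∂(haarFibre G s₁).prod (haarFibre G s₂)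
      = Real.exp (t * F V) * fibreIntegral (s₁ ∪ s₂) (fun U => old₁ U * old₂ U * Real.exp (t * F U)) V := by
  intro ρ X
  have hC0 : 0 ≤ C := le_trans (h0₁ V) (hC₁ V)
  -- measurability
  have hu₁ : Measurable (fun p : (s₁ → G) × (s₂ → G) => updateFinset V s₁ p.1) :=
    measurable_updateFinset.comp measurable_fst
  have hu₂ : Measurable (fun p : (s₁ → G) × (s₂ → G) => updateFinset V s₂ p.2) :=
    measurable_updateFinset.comp measurable_snd
  have hu₁₂ := measurable_updateFinset_pair V s₁ s₂
  have hmd₁ : Measurable (fun U : GaugeField P j G => old₁ U * Real.exp (t * F U)) :=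
    hm₁.mul (Real.measurable_exp.comp (hF.const_mul t))
  have hmd₂ : Measurable (fun U : GaugeField P j G => old₂ U * Real.exp (t * F U)) :=
    hm₂.mul (Real.measurable_exp.comp (hF.const_mul t))
  have hρm : Measurable ρ := (hmd₁.comp hu₁).mul (hmd₂.comp hu₂)
  have hRm : Measurable (fun p : (s₁ → G) × (s₂ → G) => mixedDiff F s₁ s₂ V p.1 p.2) :=
    (((hF.comp hu₁₂).sub (hF.comp hu₁)).sub (hF.comp hu₂)).add measurable_const
  have hXm : Measurable X := hRm.const_mul t
  -- positivity and bounds of the weight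
  have hexpB : ∀ U, Real.exp (t * F U) ≤ Real.exp (|t| * B) := fun U => (exp_dressing_bounds hFB t U).2
  have hd0 : ∀ {old : Density P j G}, (∀ U, 0 ≤ old U) → ∀ (s : Finset (PBond P j)) (y : s → G),
      0 ≤ dressedWeight old F t s V y := fun h0 s y => mul_nonneg (h0 _) (Real.exp_pos _).le
  have hdC : ∀ {old : Density P j G}, (∀ U, 0 ≤ old U) → (∀ U, old U ≤ C) → ∀ (s : Finset (PBond P j)) (y : s → G),
      dressedWeight old F t s V y ≤ C * Real.exp (|t| * B) := fun _ hC s y =>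
    mul_le_mul (hC _) (hexpB _) (Real.exp_pos _).le hC0
  have hρ0 : ∀ p, 0 ≤ ρ p := fun p => mul_nonneg (hd0 h0₁ s₁ p.1) (hd0 h0₂ s₂ p.2)
  have hρC : ∀ p, ρ p ≤ (C * Real.exp (|t| * B)) * (C * Real.exp (|t| * B)) := fun p =>
    mul_le_mul (hdC h0₁ hC₁ s₁ p.1) (hdC h0₂ hC₂ s₂ p.2) (hd0 h0₂ s₂ p.2) ((hd0 h0₁ s₁ p.1).trans (hdC h0₁ hC₁ s₁ p.1))
  -- the exponent on the support
  have hX : ∀ p, ρ p ≠ 0 → |X p| ≤ |t| * δ := by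
    intro p hp
    have h1 : old₁ (updateFinset V s₁ p.1) ≠ 0 := left_ne_zero_of_mul (left_ne_zero_of_mul hp)
    have h2 : old₂ (updateFinset V s₂ p.2) ≠ 0 := left_ne_zero_of_mul (right_ne_zero_of_mul hp)
    show |t * mixedDiff F s₁ s₂ V p.1 p.2| ≤ |t| * δ
    rw [abs_mul]
    exact mul_le_mul_of_nonneg_left (hmix p.1 p.2 h1 h2) (abs_nonneg t)
  refine ⟨hρm, hXm, hρ0, hρC, hX, ?_, ?_, ?_, ?_⟩
  · -- `∫ ρ = N₁ N₂`
    rw [fibreIntegral_eq_integral s₁ hmd₁ (fun U => mul_nonneg (h0₁ U) (Real.exp_pos _).le) V,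
      fibreIntegral_eq_integral s₂ hmd₂ (fun U => mul_nonneg (h0₂ U) (Real.exp_pos _).le) V]
    exact integral_prod_mul (μ := haarFibre G s₁) (ν := haarFibre G s₂)
      (dressedWeight old₁ F t s₁ V) (dressedWeight old₂ F t s₂ V)
  · -- `∫ ρ X = t M`
    rw [mixedMoment, ← integral_const_mul]
    refine integral_congr_ae (ae_of_all _ fun p => ?_)
    show ρ p * (t * mixedDiff F s₁ s₂ V p.1 p.2) = t * (dressedWeight old₁ F t s₁ V p.1 * dressedWeight old₂ F t s₂ V p.2
      * mixedDiff F s₁ s₂ V p.1 p.2)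
    ring
  · -- `∫ ρ X² = t² Q`
    rw [mixedSecondMoment, ← integral_const_mul]
    refine integral_congr_ae (ae_of_all _ fun p => ?_)
    show ρ p * (t * mixedDiff F s₁ s₂ V p.1 p.2) ^ 2 = t ^ 2 * (dressedWeight old₁ F t s₁ V p.1
      * dressedWeight old₂ F t s₂ V p.2 * mixedDiff F s₁ s₂ V p.1 p.2 ^ 2)
    ring
  · -- `∫ ρ e^X = e^{tF(V)} N₁₂`
    have hmg : Measurable (fun U : GaugeField P j G => old₁ U * old₂ U * Real.exp (t * F U)) :=
      (hm₁.mul hm₂).mul (Real.measurable_exp.comp (hF.const_mul t))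
    rw [fibreIntegral_union_eq_integral_prod hd hmg
      (fun U => mul_nonneg (mul_nonneg (h0₁ U) (h0₂ U)) (Real.exp_pos _).le) V, ← integral_const_mul]
    refine integral_congr_ae (ae_of_all _ fun p => ?_)
    have e₁ : old₁ (updateFinset (updateFinset V s₁ p.1) s₂ p.2) = old₁ (updateFinset V s₁ p.1) :=
      hI₁ (updateFinset V s₁ p.1) p.2
    have e₂ : old₂ (updateFinset (updateFinset V s₁ p.1) s₂ p.2) = old₂ (updateFinset V s₂ p.2) := by
      rw [updateFinset_updateFinset_comm hd V p.1 p.2, hI₂ (updateFinset V s₂ p.2) p.1]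
    show dressedWeight old₁ F t s₁ V p.1 * dressedWeight old₂ F t s₂ V p.2 * Real.exp (t * mixedDiff F s₁ s₂ V p.1 p.2)
      = Real.exp (t * F V) * (old₁ (updateFinset (updateFinset V s₁ p.1) s₂ p.2)
          * old₂ (updateFinset (updateFinset V s₁ p.1) s₂ p.2) * Real.exp (t * F (updateFinset (updateFinset V s₁ p.1) s₂ p.2)))
    rw [e₁, e₂]
    simp only [dressedWeight, mixedDiff]
    have e₃ : Real.exp (t * F (updateFinset V s₁ p.1)) * Real.exp (t * F (updateFinset V s₂ p.2))
        * Real.exp (t * (F (updateFinset (updateFinset V s₁ p.1) s₂ p.2) - F (updateFinset V s₁ p.1)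
            - F (updateFinset V s₂ p.2) + F V))
        = Real.exp (t * F V) * Real.exp (t * F (updateFinset (updateFinset V s₁ p.1) s₂ p.2)) := by
      rw [← Real.exp_add, ← Real.exp_add, ← Real.exp_add]; ring_nf
    calc old₁ (updateFinset V s₁ p.1) * Real.exp (t * F (updateFinset V s₁ p.1))
          * (old₂ (updateFinset V s₂ p.2) * Real.exp (t * F (updateFinset V s₂ p.2)))
          * Real.exp (t * (F (updateFinset (updateFinset V s₁ p.1) s₂ p.2) - F (updateFinset V s₁ p.1)
              - F (updateFinset V s₂ p.2) + F V))
        = old₁ (updateFinset V s₁ p.1) * old₂ (updateFinset V s₂ p.2)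
          * (Real.exp (t * F (updateFinset V s₁ p.1)) * Real.exp (t * F (updateFinset V s₂ p.2))
            * Real.exp (t * (F (updateFinset (updateFinset V s₁ p.1) s₂ p.2) - F (updateFinset V s₁ p.1)
              - F (updateFinset V s₂ p.2) + F V))) := by ring
      _ = old₁ (updateFinset V s₁ p.1) * old₂ (updateFinset V s₂ p.2)
          * (Real.exp (t * F V) * Real.exp (t * F (updateFinset (updateFinset V s₁ p.1) s₂ p.2))) := by rw [e₃]
      _ = Real.exp (t * F V) * (old₁ (updateFinset V s₁ p.1) * old₂ (updateFinset V s₂ p.2)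
          * Real.exp (t * F (updateFinset (updateFinset V s₁ p.1) s₂ p.2))) := by ring

/-- (A) THE MOMENT-TYPE TWO-BODY MAYER STEP — AFFINE SANDWICH.  Setting of `T4JointDressing.fibreIntegral_union_exp_sandwich`
(two disjoint fibres `Λ₁, Λ₂` of one term; `old₁` `Λ₂`-independent, `old₂` `Λ₁`-independent, measurable, `0 ≤ oldᵢ ≤ C`;
`F` measurable, `|F| ≤ B`; mixed second difference `|R| ≤ δ` on the supports), `Nᵢ = ∫dV⌈_{Λᵢ}(oldᵢe^{tF})(V)`,
`N₁₂ = ∫dV⌈_{Λ₁∪Λ₂}(old₁old₂e^{tF})(V)`, `M` the mixed first moment (`mixedMoment`):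
`N₁N₂ + t·M ≤ e^{tF(V)}·N₁₂ ≤ cosh(|t|δ)·N₁N₂ + (sinh(|t|δ)/(|t|δ))·t·M`.
The sup sandwich of `T4JointDressing` §3 is `e^{−|t|δ}N₁N₂ ≤ e^{tF(V)}N₁₂ ≤ e^{|t|δ}N₁N₂`; here the first moment is
carried explicitly and the rest is SECOND order in `|t|δ` (`cosh s ≤ e^{s²/2}`). [folklore] -/
theorem fibreIntegral_union_exp_moment_sandwich {s₁ s₂ : Finset (PBond P j)} (hd : Disjoint s₁ s₂)
    {old₁ old₂ : Density P j G} (F : Density P j G) (hm₁ : Measurable old₁) (hm₂ : Measurable old₂) (hF : Measurable F)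
    (h0₁ : ∀ U, 0 ≤ old₁ U) (h0₂ : ∀ U, 0 ≤ old₂ U) {C : ℝ} (hC₁ : ∀ U, old₁ U ≤ C) (hC₂ : ∀ U, old₂ U ≤ C)
    (hI₁ : FibreIndep s₂ old₁) (hI₂ : FibreIndep s₁ old₂) {B : ℝ} (hFB : ∀ U, |F U| ≤ B) (t δ : ℝ) (V : GaugeField P j G)
    (hmix : ∀ (y : s₁ → G) (z : s₂ → G), old₁ (updateFinset V s₁ y) ≠ 0 → old₂ (updateFinset V s₂ z) ≠ 0 →
      |F (updateFinset (updateFinset V s₁ y) s₂ z) - F (updateFinset V s₁ y) - F (updateFinset V s₂ z) + F V| ≤ δ) :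
    fibreIntegral s₁ (fun U => old₁ U * Real.exp (t * F U)) V * fibreIntegral s₂ (fun U => old₂ U * Real.exp (t * F U)) V
        + t * mixedMoment old₁ old₂ F t s₁ s₂ V
      ≤ Real.exp (t * F V) * fibreIntegral (s₁ ∪ s₂) (fun U => old₁ U * old₂ U * Real.exp (t * F U)) V ∧
    Real.exp (t * F V) * fibreIntegral (s₁ ∪ s₂) (fun U => old₁ U * old₂ U * Real.exp (t * F U)) V
      ≤ Real.cosh (|t| * δ) * (fibreIntegral s₁ (fun U => old₁ U * Real.exp (t * F U)) V
          * fibreIntegral s₂ (fun U => old₂ U * Real.exp (t * F U)) V)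
        + (Real.sinh (|t| * δ) / (|t| * δ)) * (t * mixedMoment old₁ old₂ F t s₁ s₂ V) := by
  obtain ⟨hρm, hXm, hρ0, hρC, hX, eN, eM, -, eP⟩ :=
    moment_data hd F hm₁ hm₂ hF h0₁ h0₂ hC₁ hC₂ hI₁ hI₂ hFB t δ V hmix
  have h := weighted_exp_sandwich (μ := (haarFibre G s₁).prod (haarFibre G s₂)) hρm hXm hρ0 hρC hX
  rw [eN, eM, eP] at h
  exact h

/-- (C) THE SECOND-MOMENT FORM on `|t|·δ ≤ 1`, with `Q` the mixed second moment (`mixedSecondMoment`):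
`N₁N₂ + t·M − t²·Q ≤ e^{tF(V)}·N₁₂ ≤ N₁N₂ + t·M + t²·Q`. [folklore] -/
theorem fibreIntegral_union_exp_second_moment {s₁ s₂ : Finset (PBond P j)} (hd : Disjoint s₁ s₂)
    {old₁ old₂ : Density P j G} (F : Density P j G) (hm₁ : Measurable old₁) (hm₂ : Measurable old₂) (hF : Measurable F)
    (h0₁ : ∀ U, 0 ≤ old₁ U) (h0₂ : ∀ U, 0 ≤ old₂ U) {C : ℝ} (hC₁ : ∀ U, old₁ U ≤ C) (hC₂ : ∀ U, old₂ U ≤ C)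
    (hI₁ : FibreIndep s₂ old₁) (hI₂ : FibreIndep s₁ old₂) {B : ℝ} (hFB : ∀ U, |F U| ≤ B) (t δ : ℝ) (V : GaugeField P j G)
    (hmix : ∀ (y : s₁ → G) (z : s₂ → G), old₁ (updateFinset V s₁ y) ≠ 0 → old₂ (updateFinset V s₂ z) ≠ 0 →
      |F (updateFinset (updateFinset V s₁ y) s₂ z) - F (updateFinset V s₁ y) - F (updateFinset V s₂ z) + F V| ≤ δ)
    (htδ : |t| * δ ≤ 1) :
    fibreIntegral s₁ (fun U => old₁ U * Real.exp (t * F U)) V * fibreIntegral s₂ (fun U => old₂ U * Real.exp (t * F U)) V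
        + t * mixedMoment old₁ old₂ F t s₁ s₂ V - t ^ 2 * mixedSecondMoment old₁ old₂ F t s₁ s₂ V
      ≤ Real.exp (t * F V) * fibreIntegral (s₁ ∪ s₂) (fun U => old₁ U * old₂ U * Real.exp (t * F U)) V ∧
    Real.exp (t * F V) * fibreIntegral (s₁ ∪ s₂) (fun U => old₁ U * old₂ U * Real.exp (t * F U)) V
      ≤ fibreIntegral s₁ (fun U => old₁ U * Real.exp (t * F U)) V * fibreIntegral s₂ (fun U => old₂ U * Real.exp (t * F U)) V
        + t * mixedMoment old₁ old₂ F t s₁ s₂ V + t ^ 2 * mixedSecondMoment old₁ old₂ F t s₁ s₂ V := by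
  obtain ⟨hρm, hXm, hρ0, hρC, hX, eN, eM, eQ, eP⟩ :=
    moment_data hd F hm₁ hm₂ hF h0₁ h0₂ hC₁ hC₂ hI₁ hI₂ hFB t δ V hmix
  have h := weighted_exp_second_moment (μ := (haarFibre G s₁).prod (haarFibre G s₂)) hρm hXm hρ0 hρC hX htδ
  rw [eN, eM, eQ, eP] at h
  exact ⟨h.2, h.1⟩

omit [GaugeGroup G] [MeasurableSpace G] [HaarData G] [DecidableEq (PBond P j)] in
/-- `|t|·m·(sinh(|t|δ)/(|t|δ)) = m·(sinh(|t|δ)/δ)` in all cases (Lean's `x/0 = 0`). [folklore] -/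
theorem abs_mul_mul_sinh_div (t δ m : ℝ) :
    |t| * m * (Real.sinh (|t| * δ) / (|t| * δ)) = m * (Real.sinh (|t| * δ) / δ) := by
  by_cases ht : t = 0
  · subst ht; simp
  · have hta : |t| ≠ 0 := abs_ne_zero.mpr ht
    rw [show |t| * m * (Real.sinh (|t| * δ) / (|t| * δ)) = m * (|t| * Real.sinh (|t| * δ) / (|t| * δ)) by ring,
      mul_div_mul_left _ _ hta]

/-- (B′) FIRST-MOMENT BUDGET ⇒ RATIO BOUNDS: if the mixed first moment is budgeted by `|M| ≤ m·N₁N₂` (a CONDITIONAL-MEAN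
bound `m` — in the cell's use second order, or zero), then
`(1 − |t|m)·N₁N₂ ≤ e^{tF(V)}·N₁₂ ≤ (cosh(|t|δ) + m·sinh(|t|δ)/δ)·N₁N₂`. [folklore] -/
theorem fibreIntegral_union_exp_ratio_bounds {s₁ s₂ : Finset (PBond P j)} (hd : Disjoint s₁ s₂)
    {old₁ old₂ : Density P j G} (F : Density P j G) (hm₁ : Measurable old₁) (hm₂ : Measurable old₂) (hF : Measurable F)
    (h0₁ : ∀ U, 0 ≤ old₁ U) (h0₂ : ∀ U, 0 ≤ old₂ U) {C : ℝ} (hC₁ : ∀ U, old₁ U ≤ C) (hC₂ : ∀ U, old₂ U ≤ C)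
    (hI₁ : FibreIndep s₂ old₁) (hI₂ : FibreIndep s₁ old₂) {B : ℝ} (hFB : ∀ U, |F U| ≤ B) (t δ : ℝ) (V : GaugeField P j G)
    (hmix : ∀ (y : s₁ → G) (z : s₂ → G), old₁ (updateFinset V s₁ y) ≠ 0 → old₂ (updateFinset V s₂ z) ≠ 0 →
      |F (updateFinset (updateFinset V s₁ y) s₂ z) - F (updateFinset V s₁ y) - F (updateFinset V s₂ z) + F V| ≤ δ)
    {m : ℝ} (hM : |mixedMoment old₁ old₂ F t s₁ s₂ V| ≤ m * (fibreIntegral s₁ (fun U => old₁ U * Real.exp (t * F U)) V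
        * fibreIntegral s₂ (fun U => old₂ U * Real.exp (t * F U)) V)) :
    (1 - |t| * m) * (fibreIntegral s₁ (fun U => old₁ U * Real.exp (t * F U)) V
          * fibreIntegral s₂ (fun U => old₂ U * Real.exp (t * F U)) V)
      ≤ Real.exp (t * F V) * fibreIntegral (s₁ ∪ s₂) (fun U => old₁ U * old₂ U * Real.exp (t * F U)) V ∧
    Real.exp (t * F V) * fibreIntegral (s₁ ∪ s₂) (fun U => old₁ U * old₂ U * Real.exp (t * F U)) V
      ≤ (Real.cosh (|t| * δ) + m * (Real.sinh (|t| * δ) / δ)) * (fibreIntegral s₁ (fun U => old₁ U * Real.exp (t * F U)) V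
          * fibreIntegral s₂ (fun U => old₂ U * Real.exp (t * F U)) V) := by
  obtain ⟨hρm, hXm, hρ0, hρC, hX, eN, eM, -, eP⟩ :=
    moment_data hd F hm₁ hm₂ hF h0₁ h0₂ hC₁ hC₂ hI₁ hI₂ hFB t δ V hmix
  have hM' : |∫ p, (dressedWeight old₁ F t s₁ V p.1 * dressedWeight old₂ F t s₂ V p.2)
        * (t * mixedDiff F s₁ s₂ V p.1 p.2) ∂(haarFibre G s₁).prod (haarFibre G s₂)|
      ≤ (|t| * m) * ∫ p, dressedWeight old₁ F t s₁ V p.1 * dressedWeight old₂ F t s₂ V p.2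
          ∂(haarFibre G s₁).prod (haarFibre G s₂) := by
    rw [eM, eN, abs_mul, mul_assoc]
    exact mul_le_mul_of_nonneg_left hM (abs_nonneg t)
  have h := weighted_exp_ratio_bounds (μ := (haarFibre G s₁).prod (haarFibre G s₂)) hρm hXm hρ0 hρC hX hM'
  rw [eN, eP, abs_mul_mul_sinh_div] at h
  exact h

/-- (B) ZERO MIXED FIRST MOMENT ⇒ `N₁N₂ ≤ e^{tF(V)}·N₁₂ ≤ cosh(|t|δ)·N₁N₂`. [folklore] -/
theorem fibreIntegral_union_exp_sandwich_of_moment_zero {s₁ s₂ : Finset (PBond P j)} (hd : Disjoint s₁ s₂)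
    {old₁ old₂ : Density P j G} (F : Density P j G) (hm₁ : Measurable old₁) (hm₂ : Measurable old₂) (hF : Measurable F)
    (h0₁ : ∀ U, 0 ≤ old₁ U) (h0₂ : ∀ U, 0 ≤ old₂ U) {C : ℝ} (hC₁ : ∀ U, old₁ U ≤ C) (hC₂ : ∀ U, old₂ U ≤ C)
    (hI₁ : FibreIndep s₂ old₁) (hI₂ : FibreIndep s₁ old₂) {B : ℝ} (hFB : ∀ U, |F U| ≤ B) (t δ : ℝ) (V : GaugeField P j G)
    (hmix : ∀ (y : s₁ → G) (z : s₂ → G), old₁ (updateFinset V s₁ y) ≠ 0 → old₂ (updateFinset V s₂ z) ≠ 0 →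
      |F (updateFinset (updateFinset V s₁ y) s₂ z) - F (updateFinset V s₁ y) - F (updateFinset V s₂ z) + F V| ≤ δ)
    (hM : mixedMoment old₁ old₂ F t s₁ s₂ V = 0) :
    fibreIntegral s₁ (fun U => old₁ U * Real.exp (t * F U)) V * fibreIntegral s₂ (fun U => old₂ U * Real.exp (t * F U)) V
      ≤ Real.exp (t * F V) * fibreIntegral (s₁ ∪ s₂) (fun U => old₁ U * old₂ U * Real.exp (t * F U)) V ∧
    Real.exp (t * F V) * fibreIntegral (s₁ ∪ s₂) (fun U => old₁ U * old₂ U * Real.exp (t * F U)) V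
      ≤ Real.cosh (|t| * δ) * (fibreIntegral s₁ (fun U => old₁ U * Real.exp (t * F U)) V
          * fibreIntegral s₂ (fun U => old₂ U * Real.exp (t * F U)) V) := by
  have h := fibreIntegral_union_exp_moment_sandwich hd F hm₁ hm₂ hF h0₁ h0₂ hC₁ hC₂ hI₁ hI₂ hFB t δ V hmix
  rw [hM, mul_zero, add_zero, mul_zero, add_zero] at h
  exact h

/-- (B, log form) ZERO MIXED FIRST MOMENT ⇒ the two-body COUPLING DEFECT is NON-NEGATIVE and SECOND ORDER:
`0 ≤ log N₁₂ − log N₁ − log N₂ + tF(V) ≤ log cosh(|t|δ) ≤ (tδ)²/2` (when the undressed fluctuation integrals are non-zero —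
the printed proviso "the denominators are positive", [Balaban1989LargeFieldI] p. 176).  Compare `T4JointDressing.abs_log_coupling_le`:
`|…| ≤ |t|δ`. [folklore] -/
theorem log_coupling_bounds_of_moment_zero {s₁ s₂ : Finset (PBond P j)} (hd : Disjoint s₁ s₂)
    {old₁ old₂ : Density P j G} (F : Density P j G) (hm₁ : Measurable old₁) (hm₂ : Measurable old₂) (hF : Measurable F)
    (h0₁ : ∀ U, 0 ≤ old₁ U) (h0₂ : ∀ U, 0 ≤ old₂ U) {C : ℝ} (hC₁ : ∀ U, old₁ U ≤ C) (hC₂ : ∀ U, old₂ U ≤ C)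
    (hI₁ : FibreIndep s₂ old₁) (hI₂ : FibreIndep s₁ old₂) {B : ℝ} (hFB : ∀ U, |F U| ≤ B) (t δ : ℝ) (V : GaugeField P j G)
    (hmix : ∀ (y : s₁ → G) (z : s₂ → G), old₁ (updateFinset V s₁ y) ≠ 0 → old₂ (updateFinset V s₂ z) ≠ 0 →
      |F (updateFinset (updateFinset V s₁ y) s₂ z) - F (updateFinset V s₁ y) - F (updateFinset V s₂ z) + F V| ≤ δ)
    (hM : mixedMoment old₁ old₂ F t s₁ s₂ V = 0)
    (hne₁ : fibreIntegral s₁ old₁ V ≠ 0) (hne₂ : fibreIntegral s₂ old₂ V ≠ 0) :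
    0 ≤ Real.log (fibreIntegral (s₁ ∪ s₂) (fun U => old₁ U * old₂ U * Real.exp (t * F U)) V)
        - Real.log (fibreIntegral s₁ (fun U => old₁ U * Real.exp (t * F U)) V)
        - Real.log (fibreIntegral s₂ (fun U => old₂ U * Real.exp (t * F U)) V) + t * F V ∧
    Real.log (fibreIntegral (s₁ ∪ s₂) (fun U => old₁ U * old₂ U * Real.exp (t * F U)) V)
        - Real.log (fibreIntegral s₁ (fun U => old₁ U * Real.exp (t * F U)) V)
        - Real.log (fibreIntegral s₂ (fun U => old₂ U * Real.exp (t * F U)) V) + t * F V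
      ≤ Real.log (Real.cosh (|t| * δ)) := by
  have h := fibreIntegral_union_exp_sandwich_of_moment_zero hd F hm₁ hm₂ hF h0₁ h0₂ hC₁ hC₂ hI₁ hI₂ hFB t δ V hmix hM
  set N₁₂ := fibreIntegral (s₁ ∪ s₂) (fun U => old₁ U * old₂ U * Real.exp (t * F U)) V with hN₁₂
  set N₁ := fibreIntegral s₁ (fun U => old₁ U * Real.exp (t * F U)) V with hN₁
  set N₂ := fibreIntegral s₂ (fun U => old₂ U * Real.exp (t * F U)) V with hN₂
  have hN₁pos : 0 < N₁ := fibreIntegral_exp_dressed_pos s₁ F h0₁ hC₁ hFB t V hne₁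
  have hN₂pos : 0 < N₂ := fibreIntegral_exp_dressed_pos s₂ F h0₂ hC₂ hFB t V hne₂
  have hNpos : 0 < N₁ * N₂ := mul_pos hN₁pos hN₂pos
  have hPpos : 0 < Real.exp (t * F V) * N₁₂ := lt_of_lt_of_le hNpos h.1
  have hN₁₂pos : 0 < N₁₂ := pos_of_mul_pos_right hPpos (Real.exp_pos _).le
  have hlogP : Real.log (Real.exp (t * F V) * N₁₂) = t * F V + Real.log N₁₂ := by
    rw [Real.log_mul (Real.exp_pos _).ne' hN₁₂pos.ne', Real.log_exp]
  have hlogN : Real.log (N₁ * N₂) = Real.log N₁ + Real.log N₂ := Real.log_mul hN₁pos.ne' hN₂pos.ne'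
  have hlo := Real.log_le_log hNpos h.1
  have hhi := Real.log_le_log hPpos h.2
  rw [hlogP] at hlo hhi
  rw [hlogN] at hlo
  rw [Real.log_mul (Real.cosh_pos _).ne' hNpos.ne', hlogN] at hhi
  constructor <;> linarith

/-- (B, D-term form) With any convention `D_Λ := log(∫⌈_Λ(old·e^{tF})/∫⌈_Λ old) − tF(V)` (the dressing defect of node O3b (i)
at base point `V`; the undressed joint integral FACTORISES, `T4JointDressing.fibreIntegral_union_mul_eq`), a zero mixed first
moment gives `0 ≤ D_{Λ₁∪Λ₂} − D_{Λ₁} − D_{Λ₂} ≤ log cosh(|t|δ)`: the two-body remainder `R₁₂` of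
`T4JointDressing.abs_defect_union_sub_le` is then NON-NEGATIVE and SECOND ORDER. [folklore] -/
theorem defect_union_sub_bounds_of_moment_zero {s₁ s₂ : Finset (PBond P j)} (hd : Disjoint s₁ s₂)
    {old₁ old₂ : Density P j G} (F : Density P j G) (hm₁ : Measurable old₁) (hm₂ : Measurable old₂) (hF : Measurable F)
    (h0₁ : ∀ U, 0 ≤ old₁ U) (h0₂ : ∀ U, 0 ≤ old₂ U) {C : ℝ} (hC₁ : ∀ U, old₁ U ≤ C) (hC₂ : ∀ U, old₂ U ≤ C)
    (hI₁ : FibreIndep s₂ old₁) (hI₂ : FibreIndep s₁ old₂) {B : ℝ} (hFB : ∀ U, |F U| ≤ B) (t δ : ℝ) (V : GaugeField P j G)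
    (hmix : ∀ (y : s₁ → G) (z : s₂ → G), old₁ (updateFinset V s₁ y) ≠ 0 → old₂ (updateFinset V s₂ z) ≠ 0 →
      |F (updateFinset (updateFinset V s₁ y) s₂ z) - F (updateFinset V s₁ y) - F (updateFinset V s₂ z) + F V| ≤ δ)
    (hM : mixedMoment old₁ old₂ F t s₁ s₂ V = 0)
    (hne₁ : fibreIntegral s₁ old₁ V ≠ 0) (hne₂ : fibreIntegral s₂ old₂ V ≠ 0) :
    0 ≤ (Real.log (fibreIntegral (s₁ ∪ s₂) (fun U => old₁ U * old₂ U * Real.exp (t * F U)) V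
          / fibreIntegral (s₁ ∪ s₂) (fun U => old₁ U * old₂ U) V) - t * F V)
      - (Real.log (fibreIntegral s₁ (fun U => old₁ U * Real.exp (t * F U)) V / fibreIntegral s₁ old₁ V) - t * F V)
      - (Real.log (fibreIntegral s₂ (fun U => old₂ U * Real.exp (t * F U)) V / fibreIntegral s₂ old₂ V) - t * F V) ∧
    (Real.log (fibreIntegral (s₁ ∪ s₂) (fun U => old₁ U * old₂ U * Real.exp (t * F U)) V
          / fibreIntegral (s₁ ∪ s₂) (fun U => old₁ U * old₂ U) V) - t * F V)
      - (Real.log (fibreIntegral s₁ (fun U => old₁ U * Real.exp (t * F U)) V / fibreIntegral s₁ old₁ V) - t * F V)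
      - (Real.log (fibreIntegral s₂ (fun U => old₂ U * Real.exp (t * F U)) V / fibreIntegral s₂ old₂ V) - t * F V)
      ≤ Real.log (Real.cosh (|t| * δ)) := by
  have h := log_coupling_bounds_of_moment_zero hd F hm₁ hm₂ hF h0₁ h0₂ hC₁ hC₂ hI₁ hI₂ hFB t δ V hmix hM hne₁ hne₂
  have hN₁pos := fibreIntegral_exp_dressed_pos s₁ F h0₁ hC₁ hFB t V hne₁
  have hN₂pos := fibreIntegral_exp_dressed_pos s₂ F h0₂ hC₂ hFB t V hne₂
  have hsw := fibreIntegral_union_exp_sandwich_of_moment_zero hd F hm₁ hm₂ hF h0₁ h0₂ hC₁ hC₂ hI₁ hI₂ hFB t δ V hmix hM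
  have hPpos := lt_of_lt_of_le (mul_pos hN₁pos hN₂pos) hsw.1
  have hN₁₂pos := pos_of_mul_pos_right hPpos (Real.exp_pos _).le
  have e : (Real.log (fibreIntegral (s₁ ∪ s₂) (fun U => old₁ U * old₂ U * Real.exp (t * F U)) V
          / fibreIntegral (s₁ ∪ s₂) (fun U => old₁ U * old₂ U) V) - t * F V)
      - (Real.log (fibreIntegral s₁ (fun U => old₁ U * Real.exp (t * F U)) V / fibreIntegral s₁ old₁ V) - t * F V)
      - (Real.log (fibreIntegral s₂ (fun U => old₂ U * Real.exp (t * F U)) V / fibreIntegral s₂ old₂ V) - t * F V)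
      = Real.log (fibreIntegral (s₁ ∪ s₂) (fun U => old₁ U * old₂ U * Real.exp (t * F U)) V)
        - Real.log (fibreIntegral s₁ (fun U => old₁ U * Real.exp (t * F U)) V)
        - Real.log (fibreIntegral s₂ (fun U => old₂ U * Real.exp (t * F U)) V) + t * F V := by
    rw [fibreIntegral_union_mul_eq hd hm₁ hm₂ h0₁ hC₁ hC₂ hI₁ hI₂ V, Real.log_div hN₁₂pos.ne' (mul_ne_zero hne₁ hne₂),
      Real.log_mul hne₁ hne₂, Real.log_div hN₁pos.ne' hne₁, Real.log_div hN₂pos.ne' hne₂]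
    ring
  rw [e]
  exact h

/-- (B′, log form) FIRST-MOMENT BUDGET `|M| ≤ m·N₁N₂` with `|t|·m < 1` ⇒
`log(1 − |t|m) ≤ log N₁₂ − log N₁ − log N₂ + tF(V) ≤ log(cosh(|t|δ) + m·sinh(|t|δ)/δ)` (undressed fluctuation integrals
non-zero).  With `m` second order (the cell's co-read budget) both ends are second order in the pair smallness. [folklore] -/
theorem log_coupling_bounds_of_budget {s₁ s₂ : Finset (PBond P j)} (hd : Disjoint s₁ s₂)
    {old₁ old₂ : Density P j G} (F : Density P j G) (hm₁ : Measurable old₁) (hm₂ : Measurable old₂) (hF : Measurable F)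
    (h0₁ : ∀ U, 0 ≤ old₁ U) (h0₂ : ∀ U, 0 ≤ old₂ U) {C : ℝ} (hC₁ : ∀ U, old₁ U ≤ C) (hC₂ : ∀ U, old₂ U ≤ C)
    (hI₁ : FibreIndep s₂ old₁) (hI₂ : FibreIndep s₁ old₂) {B : ℝ} (hFB : ∀ U, |F U| ≤ B) (t δ : ℝ) (V : GaugeField P j G)
    (hmix : ∀ (y : s₁ → G) (z : s₂ → G), old₁ (updateFinset V s₁ y) ≠ 0 → old₂ (updateFinset V s₂ z) ≠ 0 →
      |F (updateFinset (updateFinset V s₁ y) s₂ z) - F (updateFinset V s₁ y) - F (updateFinset V s₂ z) + F V| ≤ δ)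
    {m : ℝ} (hM : |mixedMoment old₁ old₂ F t s₁ s₂ V| ≤ m * (fibreIntegral s₁ (fun U => old₁ U * Real.exp (t * F U)) V
        * fibreIntegral s₂ (fun U => old₂ U * Real.exp (t * F U)) V)) (htm : |t| * m < 1)
    (hne₁ : fibreIntegral s₁ old₁ V ≠ 0) (hne₂ : fibreIntegral s₂ old₂ V ≠ 0) :
    Real.log (1 - |t| * m) ≤ Real.log (fibreIntegral (s₁ ∪ s₂) (fun U => old₁ U * old₂ U * Real.exp (t * F U)) V)
        - Real.log (fibreIntegral s₁ (fun U => old₁ U * Real.exp (t * F U)) V)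
        - Real.log (fibreIntegral s₂ (fun U => old₂ U * Real.exp (t * F U)) V) + t * F V ∧
    Real.log (fibreIntegral (s₁ ∪ s₂) (fun U => old₁ U * old₂ U * Real.exp (t * F U)) V)
        - Real.log (fibreIntegral s₁ (fun U => old₁ U * Real.exp (t * F U)) V)
        - Real.log (fibreIntegral s₂ (fun U => old₂ U * Real.exp (t * F U)) V) + t * F V
      ≤ Real.log (Real.cosh (|t| * δ) + m * (Real.sinh (|t| * δ) / δ)) := by
  have h := fibreIntegral_union_exp_ratio_bounds hd F hm₁ hm₂ hF h0₁ h0₂ hC₁ hC₂ hI₁ hI₂ hFB t δ V hmix hM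
  set N₁₂ := fibreIntegral (s₁ ∪ s₂) (fun U => old₁ U * old₂ U * Real.exp (t * F U)) V with hN₁₂
  set N₁ := fibreIntegral s₁ (fun U => old₁ U * Real.exp (t * F U)) V with hN₁
  set N₂ := fibreIntegral s₂ (fun U => old₂ U * Real.exp (t * F U)) V with hN₂
  have hN₁pos : 0 < N₁ := fibreIntegral_exp_dressed_pos s₁ F h0₁ hC₁ hFB t V hne₁
  have hN₂pos : 0 < N₂ := fibreIntegral_exp_dressed_pos s₂ F h0₂ hC₂ hFB t V hne₂
  have hNpos : 0 < N₁ * N₂ := mul_pos hN₁pos hN₂pos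
  have hlpos : 0 < 1 - |t| * m := by linarith
  have hPpos : 0 < Real.exp (t * F V) * N₁₂ := lt_of_lt_of_le (mul_pos hlpos hNpos) h.1
  have hN₁₂pos : 0 < N₁₂ := pos_of_mul_pos_right hPpos (Real.exp_pos _).le
  have hupos : 0 < Real.cosh (|t| * δ) + m * (Real.sinh (|t| * δ) / δ) :=
    pos_of_mul_pos_left (lt_of_lt_of_le hPpos h.2) hNpos.le
  have hlogP : Real.log (Real.exp (t * F V) * N₁₂) = t * F V + Real.log N₁₂ := by
    rw [Real.log_mul (Real.exp_pos _).ne' hN₁₂pos.ne', Real.log_exp]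
  have hlogN : Real.log (N₁ * N₂) = Real.log N₁ + Real.log N₂ := Real.log_mul hN₁pos.ne' hN₂pos.ne'
  have hlo := Real.log_le_log (mul_pos hlpos hNpos) h.1
  have hhi := Real.log_le_log hPpos h.2
  rw [hlogP] at hlo hhi
  rw [Real.log_mul hlpos.ne' hNpos.ne', hlogN] at hlo
  rw [Real.log_mul hupos.ne' hNpos.ne', hlogN] at hhi
  constructor <;> linarith

/-- The second-order size of the zero-moment defect bound: `log cosh(|t|δ) ≤ (tδ)²/2 = t²δ²/2`. [folklore] -/
theorem log_cosh_abs_mul_le (t δ : ℝ) : Real.log (Real.cosh (|t| * δ)) ≤ t ^ 2 * δ ^ 2 / 2 := by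
  have h := log_cosh_le_half_sq (|t| * δ)
  rw [mul_pow, sq_abs] at h
  exact h

/-- (D) A STRUCTURAL SUFFICIENT CONDITION FOR A FIRST-MOMENT BUDGET (hypothesis only — NOT PRINTED; the cell's zero-mean
MECHANISM for co-read pairs is another seat's kernel lemma): if a Haar-fibre-measure-preserving map `σ` of the `Λ₂`-variables
leaves the dressed `Λ₂`-weight invariant (`old₂(V←σz) = old₂(V←z)`, `F(V←σz) = F(V←z)`) and the mixed difference splits as
`R = R₁ + R₂` with `R₁(y, σz) = −R₁(y, z)` (ODD part) and `|R₂| ≤ m` on the supports (EVEN remainder), then `|M| ≤ m·N₁N₂`: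
the odd part drops out of the first moment. [folklore] -/
theorem abs_mixedMoment_le_of_antisymm {s₁ s₂ : Finset (PBond P j)} {old₁ old₂ : Density P j G} (F : Density P j G)
    (hm₁ : Measurable old₁) (hm₂ : Measurable old₂) (hF : Measurable F)
    (h0₁ : ∀ U, 0 ≤ old₁ U) (h0₂ : ∀ U, 0 ≤ old₂ U) {C : ℝ} (hC₁ : ∀ U, old₁ U ≤ C) (hC₂ : ∀ U, old₂ U ≤ C)
    {B : ℝ} (hFB : ∀ U, |F U| ≤ B) (t : ℝ) (V : GaugeField P j G)
    {σ : (s₂ → G) → (s₂ → G)} (hσ : MeasurePreserving σ (haarFibre G s₂) (haarFibre G s₂))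
    (hσo : ∀ z, old₂ (updateFinset V s₂ (σ z)) = old₂ (updateFinset V s₂ z))
    (hσF : ∀ z, F (updateFinset V s₂ (σ z)) = F (updateFinset V s₂ z))
    {R₁ R₂ : (s₁ → G) → (s₂ → G) → ℝ} (hR₁m : Measurable (fun p : (s₁ → G) × (s₂ → G) => R₁ p.1 p.2))
    (hsplit : ∀ y z, old₁ (updateFinset V s₁ y) ≠ 0 → old₂ (updateFinset V s₂ z) ≠ 0 →
      mixedDiff F s₁ s₂ V y z = R₁ y z + R₂ y z)
    (hodd : ∀ y z, R₁ y (σ z) = -R₁ y z) {m : ℝ}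
    (heven : ∀ y z, old₁ (updateFinset V s₁ y) ≠ 0 → old₂ (updateFinset V s₂ z) ≠ 0 → |R₂ y z| ≤ m) :
    |mixedMoment old₁ old₂ F t s₁ s₂ V| ≤ m * (fibreIntegral s₁ (fun U => old₁ U * Real.exp (t * F U)) V
        * fibreIntegral s₂ (fun U => old₂ U * Real.exp (t * F U)) V) := by
  -- notation
  set a := dressedWeight old₁ F t s₁ V with ha
  set b := dressedWeight old₂ F t s₂ V with hb
  set μ₁ := haarFibre G s₁ with hμ₁
  set μ₂ := haarFibre G s₂ with hμ₂
  have hC0 : 0 ≤ C := le_trans (h0₁ V) (hC₁ V)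
  have hmd₁ : Measurable (fun U : GaugeField P j G => old₁ U * Real.exp (t * F U)) :=
    hm₁.mul (Real.measurable_exp.comp (hF.const_mul t))
  have hmd₂ : Measurable (fun U : GaugeField P j G => old₂ U * Real.exp (t * F U)) :=
    hm₂.mul (Real.measurable_exp.comp (hF.const_mul t))
  have ham : Measurable a := hmd₁.comp measurable_updateFinset
  have hbm : Measurable b := hmd₂.comp measurable_updateFinset
  have ha0 : ∀ y, 0 ≤ a y := fun y => mul_nonneg (h0₁ _) (Real.exp_pos _).le
  have hb0 : ∀ z, 0 ≤ b z := fun z => mul_nonneg (h0₂ _) (Real.exp_pos _).le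
  have hexpB : ∀ U, Real.exp (t * F U) ≤ Real.exp (|t| * B) := fun U => (exp_dressing_bounds hFB t U).2
  have haC : ∀ y, a y ≤ C * Real.exp (|t| * B) := fun y => mul_le_mul (hC₁ _) (hexpB _) (Real.exp_pos _).le hC0
  have hbC : ∀ z, b z ≤ C * Real.exp (|t| * B) := fun z => mul_le_mul (hC₂ _) (hexpB _) (Real.exp_pos _).le hC0
  have hbσ : ∀ z, b (σ z) = b z := fun z => by simp only [hb, dressedWeight, hσo z, hσF z]
  -- support facts
  have hsupp : ∀ y z, a y * b z ≠ 0 → old₁ (updateFinset V s₁ y) ≠ 0 ∧ old₂ (updateFinset V s₂ z) ≠ 0 := fun y z h =>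
    ⟨left_ne_zero_of_mul (left_ne_zero_of_mul h), left_ne_zero_of_mul (right_ne_zero_of_mul h)⟩
  -- split the integrand on the support: `a b R = a b R₁ + a b R₂'` with `R₂' := R − R₁` (equal to `R₂` on the support)
  set R := mixedDiff F s₁ s₂ V with hR
  have hRm : Measurable (fun p : (s₁ → G) × (s₂ → G) => R p.1 p.2) := by
    have hu₁ : Measurable (fun p : (s₁ → G) × (s₂ → G) => updateFinset V s₁ p.1) :=
      measurable_updateFinset.comp measurable_fst
    have hu₂ : Measurable (fun p : (s₁ → G) × (s₂ → G) => updateFinset V s₂ p.2) :=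
      measurable_updateFinset.comp measurable_snd
    exact (((hF.comp (measurable_updateFinset_pair V s₁ s₂)).sub (hF.comp hu₁)).sub (hF.comp hu₂)).add measurable_const
  have hρm : Measurable (fun p : (s₁ → G) × (s₂ → G) => a p.1 * b p.2) :=
    (ham.comp measurable_fst).mul (hbm.comp measurable_snd)
  -- integrability of the two pieces (bounded measurable on a finite measure)
  set K₀ := C * Real.exp (|t| * B) with hK₀
  have hK₀0 : 0 ≤ K₀ := mul_nonneg hC0 (Real.exp_pos _).le
  have hB0 : 0 ≤ B := (abs_nonneg _).trans (hFB V)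
  have hK : ∀ p : (s₁ → G) × (s₂ → G), |a p.1 * b p.2| ≤ K₀ * K₀ := fun p => by
    rw [abs_of_nonneg (mul_nonneg (ha0 _) (hb0 _))]
    exact mul_le_mul (haC _) (hbC _) (hb0 _) ((ha0 p.1).trans (haC p.1))
  have hRbd : ∀ p : (s₁ → G) × (s₂ → G), |R p.1 p.2| ≤ 4 * B := by
    intro p
    simp only [hR, mixedDiff]
    have h₁ := hFB (updateFinset (updateFinset V s₁ p.1) s₂ p.2); have h₂ := hFB (updateFinset V s₁ p.1)
    have h₃ := hFB (updateFinset V s₂ p.2); have h₄ := hFB V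
    rw [abs_le] at h₁ h₂ h₃ h₄ ⊢; constructor <;> linarith [h₁.1, h₁.2, h₂.1, h₂.2, h₃.1, h₃.2, h₄.1, h₄.2]
  have hR₁bd : ∀ p : (s₁ → G) × (s₂ → G), |a p.1 * b p.2 * R₁ p.1 p.2| ≤ K₀ * K₀ * (4 * B + |m|) := by
    intro p
    by_cases hz : a p.1 * b p.2 = 0
    · rw [hz, zero_mul, abs_zero]; exact mul_nonneg (mul_nonneg hK₀0 hK₀0) (by positivity)
    · obtain ⟨h1, h2⟩ := hsupp p.1 p.2 hz
      have hR₁eq : R₁ p.1 p.2 = R p.1 p.2 - R₂ p.1 p.2 := by rw [hsplit p.1 p.2 h1 h2]; ring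
      have hR₁abs : |R₁ p.1 p.2| ≤ 4 * B + |m| := by
        rw [hR₁eq]
        refine (abs_sub _ _).trans ?_
        exact add_le_add (hRbd p) ((heven p.1 p.2 h1 h2).trans (le_abs_self m))
      rw [abs_mul]
      exact mul_le_mul (hK p) hR₁abs (abs_nonneg _) (mul_nonneg hK₀0 hK₀0)
  have key : ∀ {f : (s₁ → G) × (s₂ → G) → ℝ}, Measurable f → ∀ {K : ℝ}, (∀ p, |f p| ≤ K) →
      Integrable f (μ₁.prod μ₂) := fun hf K hK =>
    (integrable_const K).mono' hf.aestronglyMeasurable (ae_of_all _ fun p => by rw [Real.norm_eq_abs]; exact hK p)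
  have hi₁ : Integrable (fun p : (s₁ → G) × (s₂ → G) => a p.1 * b p.2 * R₁ p.1 p.2) (μ₁.prod μ₂) :=
    key (hρm.mul hR₁m) hR₁bd
  have hiR : Integrable (fun p : (s₁ → G) × (s₂ → G) => a p.1 * b p.2 * R p.1 p.2) (μ₁.prod μ₂) := by
    refine key (hρm.mul hRm) (K := K₀ * K₀ * (4 * B)) fun p => ?_
    rw [abs_mul]
    exact mul_le_mul (hK p) (hRbd p) (abs_nonneg _) (mul_nonneg hK₀0 hK₀0)
  -- the odd piece integrates to zero (Fubini + the antisymmetry in `z`)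
  have hodd0 : ∫ p, a p.1 * b p.2 * R₁ p.1 p.2 ∂(μ₁.prod μ₂) = 0 := by
    rw [integral_prod _ hi₁]
    have hin : ∀ y, ∫ z, a y * b z * R₁ y z ∂μ₂ = 0 := by
      intro y
      refine integral_eq_zero_of_antisymm (μ := μ₂) hσ ((measurable_const.mul hbm).mul ?_) (fun z => ?_)
      · exact hR₁m.comp (measurable_const.prodMk measurable_id)
      · rw [hbσ z, hodd y z]; ring
    simp_rw [hin]
    simp
  -- the even piece is budgeted by `m ∫ a b = m N₁ N₂`
  have hdiff : ∀ p : (s₁ → G) × (s₂ → G), |a p.1 * b p.2 * R p.1 p.2 - a p.1 * b p.2 * R₁ p.1 p.2| ≤ m * (a p.1 * b p.2) := by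
    intro p
    by_cases hz : a p.1 * b p.2 = 0
    · rw [hz]; simp
    · obtain ⟨h1, h2⟩ := hsupp p.1 p.2 hz
      have e : a p.1 * b p.2 * R p.1 p.2 - a p.1 * b p.2 * R₁ p.1 p.2 = a p.1 * b p.2 * R₂ p.1 p.2 := by
        rw [show R p.1 p.2 = R₁ p.1 p.2 + R₂ p.1 p.2 from hsplit p.1 p.2 h1 h2]; ring
      rw [e, abs_mul, abs_of_nonneg (mul_nonneg (ha0 _) (hb0 _)), mul_comm m]
      exact mul_le_mul_of_nonneg_left (heven p.1 p.2 h1 h2) (mul_nonneg (ha0 _) (hb0 _))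
  have hN : ∫ p, a p.1 * b p.2 ∂(μ₁.prod μ₂) = fibreIntegral s₁ (fun U => old₁ U * Real.exp (t * F U)) V
      * fibreIntegral s₂ (fun U => old₂ U * Real.exp (t * F U)) V := by
    rw [fibreIntegral_eq_integral s₁ hmd₁ (fun U => mul_nonneg (h0₁ U) (Real.exp_pos _).le) V,
      fibreIntegral_eq_integral s₂ hmd₂ (fun U => mul_nonneg (h0₂ U) (Real.exp_pos _).le) V]
    exact integral_prod_mul (μ := μ₁) (ν := μ₂) a b
  have hM : mixedMoment old₁ old₂ F t s₁ s₂ V = ∫ p, a p.1 * b p.2 * R p.1 p.2 ∂(μ₁.prod μ₂) := rfl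
  rw [hM, ← hN, ← sub_zero (∫ p, a p.1 * b p.2 * R p.1 p.2 ∂(μ₁.prod μ₂)), ← hodd0, ← integral_sub hiR hi₁,
    ← integral_const_mul]
  refine (abs_integral_le_integral_abs).trans (integral_mono_of_nonneg (ae_of_all _ fun p => abs_nonneg _)
    ((key hρm hK).const_mul m) (ae_of_all _ fun p => hdiff p))

end SetupLevel

/-! ## §4 LOOP-LANGUAGE CONSUMER: the moment sandwich for the loop dressing of two components of one term, under the
separated pair shape `T4JointDressing.LoopPairOscBoundSep` (δ = `C₂·|w|·|Λ₁|·|Λ₂|·θ₁ⁿ·θₓ^{n′}`) -/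

section ConsumerSep

variable {P : Params} {j : ℕ} {G : Type*} [GaugeGroup G] [MeasurableSpace G] [HaarData G]
variable [DecidableEq (PBond P j)]

omit [HaarData G] in
/-- THE MIXED-DIFFERENCE HYPOTHESIS OF §3 DISCHARGED BY THE PAIR SHAPE: under `LoopPairOscBoundSep av dom C₂ θ₁ θₓ`, for a closed
walk at level `j + n ≤ m + K`, two disjoint components `Λ₁, Λ₂` whose source site sets `S ⊇ src Λ₁`, `S′ ⊇ src Λ₂` have disjoint
`n′`-step influence sets (`n′ ≤ n`), densities `old₁` (`Λ₂`-independent) and `old₂` SUPPORTED IN THE DOMAIN and a base point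
`V ∈ dom j`, the exponent `F = W_C∘avg^n` (`T4OscSandwich.loopDressing`) has mixed second difference at most
`C₂·|w|·|Λ₁|·|Λ₂|·θ₁ⁿ·θₓ^{n′}` on the supports — exactly the `hmix` hypothesis of every theorem of §3. [folklore] -/
theorem loopDressing_mixed_le_sep [RegularGaugeGroup G] {av : ∀ i, Averaging P i G}
    {dom : ∀ i, Set (GaugeField P i G)} {C₂ θ₁ θₓ : ℝ} (hW : LoopPairOscBoundSep av dom C₂ θ₁ θₓ)
    (n : ℕ) (hn : j + n ≤ P.m + P.K) (x : Site P (j + n)) (w : List (Letter P.d)) (hw : walkEnd x w = x)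
    {s₁ s₂ : Finset (PBond P j)} (hd : Disjoint s₁ s₂) {S S' : Set (Site P j)} (hS : ∀ b ∈ s₁, b.src ∈ S)
    (hS' : ∀ b ∈ s₂, b.src ∈ S') (n' : ℕ) (hn' : n' ≤ n) (hsep : Disjoint (infl S n') (infl S' n'))
    {old₁ old₂ : Density P j G} (hI₁ : FibreIndep s₂ old₁)
    (hdom₁ : ∀ U, old₁ U ≠ 0 → U ∈ dom j) (hdom₂ : ∀ U, old₂ U ≠ 0 → U ∈ dom j)
    (V : GaugeField P j G) (hV : V ∈ dom j) :
    ∀ (y : s₁ → G) (z : s₂ → G), old₁ (updateFinset V s₁ y) ≠ 0 → old₂ (updateFinset V s₂ z) ≠ 0 →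
      |loopDressing av j n x w (updateFinset (updateFinset V s₁ y) s₂ z) - loopDressing av j n x w (updateFinset V s₁ y)
        - loopDressing av j n x w (updateFinset V s₂ z) + loopDressing av j n x w V|
        ≤ C₂ * (w.length : ℝ) * (s₁.card : ℝ) * (s₂.card : ℝ) * θ₁ ^ n * θₓ ^ n' := by
  intro y z hy hz
  have hV₁ : updateFinset V s₁ y ∈ dom j := hdom₁ _ hy
  have hV₂ : updateFinset V s₂ z ∈ dom j := hdom₂ _ hz
  have hV₁₂ : updateFinset (updateFinset V s₁ y) s₂ z ∈ dom j := by
    refine hdom₁ _ ?_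
    rw [hI₁ (updateFinset V s₁ y) z]; exact hy
  exact hW.updateFinset n hn x w hw hd hS hS' n' hn' hsep V y z hV hV₁ hV₂ hV₁₂

/-- WHERE THE MOMENT-TYPE STEP IS SPENT (one basic step, one term, two components not met by level `j + n′`): the affine
sandwich (A) of §3 for the dressing `w = exp(t·W_C(avg^n ·))` with `δ = C₂·|w|·|Λ₁|·|Λ₂|·θ₁ⁿ·θₓ^{n′}` — the jointly dressed
fluctuation integral over `Λ₁ ∪ Λ₂` is `e^{−tW(V)}·(N₁N₂ + t·M + O((tδ)²·N₁N₂))` with the mixed first moment `M` of the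
loop variable carried EXPLICITLY (the sup sandwich `T4JointDressing.fibreIntegral_union_loopDressing_sandwich_sep` gives
`e^{±|t|δ}`). [folklore] -/
theorem fibreIntegral_union_loopDressing_moment_sandwich_sep [RegularGaugeGroup G] {av : ∀ i, Averaging P i G}
    {dom : ∀ i, Set (GaugeField P i G)} {C₂ θ₁ θₓ : ℝ} (hW : LoopPairOscBoundSep av dom C₂ θ₁ θₓ)
    (n : ℕ) (hn : j + n ≤ P.m + P.K) (x : Site P (j + n)) (w : List (Letter P.d)) (hw : walkEnd x w = x)
    (hFm : Measurable (loopDressing av j n x w))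
    {s₁ s₂ : Finset (PBond P j)} (hd : Disjoint s₁ s₂) {S S' : Set (Site P j)} (hS : ∀ b ∈ s₁, b.src ∈ S)
    (hS' : ∀ b ∈ s₂, b.src ∈ S') (n' : ℕ) (hn' : n' ≤ n) (hsep : Disjoint (infl S n') (infl S' n'))
    {old₁ old₂ : Density P j G}
    (hm₁ : Measurable old₁) (hm₂ : Measurable old₂) (h0₁ : ∀ U, 0 ≤ old₁ U) (h0₂ : ∀ U, 0 ≤ old₂ U)
    {C : ℝ} (hC₁ : ∀ U, old₁ U ≤ C) (hC₂ : ∀ U, old₂ U ≤ C) (hI₁ : FibreIndep s₂ old₁) (hI₂ : FibreIndep s₁ old₂)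
    (hdom₁ : ∀ U, old₁ U ≠ 0 → U ∈ dom j) (hdom₂ : ∀ U, old₂ U ≠ 0 → U ∈ dom j)
    (t : ℝ) (V : GaugeField P j G) (hV : V ∈ dom j) :
    fibreIntegral s₁ (fun U => old₁ U * Real.exp (t * loopDressing av j n x w U)) V
          * fibreIntegral s₂ (fun U => old₂ U * Real.exp (t * loopDressing av j n x w U)) V
        + t * mixedMoment old₁ old₂ (loopDressing av j n x w) t s₁ s₂ V
      ≤ Real.exp (t * loopDressing av j n x w V)
          * fibreIntegral (s₁ ∪ s₂) (fun U => old₁ U * old₂ U * Real.exp (t * loopDressing av j n x w U)) V ∧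
    Real.exp (t * loopDressing av j n x w V)
          * fibreIntegral (s₁ ∪ s₂) (fun U => old₁ U * old₂ U * Real.exp (t * loopDressing av j n x w U)) V
      ≤ Real.cosh (|t| * (C₂ * (w.length : ℝ) * (s₁.card : ℝ) * (s₂.card : ℝ) * θ₁ ^ n * θₓ ^ n'))
          * (fibreIntegral s₁ (fun U => old₁ U * Real.exp (t * loopDressing av j n x w U)) V
            * fibreIntegral s₂ (fun U => old₂ U * Real.exp (t * loopDressing av j n x w U)) V)
        + (Real.sinh (|t| * (C₂ * (w.length : ℝ) * (s₁.card : ℝ) * (s₂.card : ℝ) * θ₁ ^ n * θₓ ^ n'))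
            / (|t| * (C₂ * (w.length : ℝ) * (s₁.card : ℝ) * (s₂.card : ℝ) * θ₁ ^ n * θₓ ^ n')))
          * (t * mixedMoment old₁ old₂ (loopDressing av j n x w) t s₁ s₂ V) :=
  fibreIntegral_union_exp_moment_sandwich hd (loopDressing av j n x w) hm₁ hm₂ hFm h0₁ h0₂ hC₁ hC₂ hI₁ hI₂
    (B := 1) (fun _ => abs_loopAt_le_one _ _) t _ V
    (loopDressing_mixed_le_sep hW n hn x w hw hd hS hS' n' hn' hsep hI₁ hdom₁ hdom₂ V hV)

/-- … AND ITS FIRST-MOMENT-BUDGET FORM (B′): with `|M| ≤ m·N₁N₂` (the conditional-mean budget of the co-read pair — the cell's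
NAMED hypothesis, another seat's kernel lemma), `(1 − |t|m)·N₁N₂ ≤ e^{tW(V)}·N₁₂ ≤ (cosh(|t|δ) + m·sinh(|t|δ)/δ)·N₁N₂`,
`δ = C₂·|w|·|Λ₁|·|Λ₂|·θ₁ⁿ·θₓ^{n′}`. [folklore] -/
theorem fibreIntegral_union_loopDressing_ratio_bounds_sep [RegularGaugeGroup G] {av : ∀ i, Averaging P i G}
    {dom : ∀ i, Set (GaugeField P i G)} {C₂ θ₁ θₓ : ℝ} (hW : LoopPairOscBoundSep av dom C₂ θ₁ θₓ)
    (n : ℕ) (hn : j + n ≤ P.m + P.K) (x : Site P (j + n)) (w : List (Letter P.d)) (hw : walkEnd x w = x)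
    (hFm : Measurable (loopDressing av j n x w))
    {s₁ s₂ : Finset (PBond P j)} (hd : Disjoint s₁ s₂) {S S' : Set (Site P j)} (hS : ∀ b ∈ s₁, b.src ∈ S)
    (hS' : ∀ b ∈ s₂, b.src ∈ S') (n' : ℕ) (hn' : n' ≤ n) (hsep : Disjoint (infl S n') (infl S' n'))
    {old₁ old₂ : Density P j G}
    (hm₁ : Measurable old₁) (hm₂ : Measurable old₂) (h0₁ : ∀ U, 0 ≤ old₁ U) (h0₂ : ∀ U, 0 ≤ old₂ U)
    {C : ℝ} (hC₁ : ∀ U, old₁ U ≤ C) (hC₂ : ∀ U, old₂ U ≤ C) (hI₁ : FibreIndep s₂ old₁) (hI₂ : FibreIndep s₁ old₂)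
    (hdom₁ : ∀ U, old₁ U ≠ 0 → U ∈ dom j) (hdom₂ : ∀ U, old₂ U ≠ 0 → U ∈ dom j)
    (t : ℝ) (V : GaugeField P j G) (hV : V ∈ dom j) {m : ℝ}
    (hM : |mixedMoment old₁ old₂ (loopDressing av j n x w) t s₁ s₂ V|
      ≤ m * (fibreIntegral s₁ (fun U => old₁ U * Real.exp (t * loopDressing av j n x w U)) V
          * fibreIntegral s₂ (fun U => old₂ U * Real.exp (t * loopDressing av j n x w U)) V)) :
    (1 - |t| * m) * (fibreIntegral s₁ (fun U => old₁ U * Real.exp (t * loopDressing av j n x w U)) V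
          * fibreIntegral s₂ (fun U => old₂ U * Real.exp (t * loopDressing av j n x w U)) V)
      ≤ Real.exp (t * loopDressing av j n x w V)
          * fibreIntegral (s₁ ∪ s₂) (fun U => old₁ U * old₂ U * Real.exp (t * loopDressing av j n x w U)) V ∧
    Real.exp (t * loopDressing av j n x w V)
          * fibreIntegral (s₁ ∪ s₂) (fun U => old₁ U * old₂ U * Real.exp (t * loopDressing av j n x w U)) V
      ≤ (Real.cosh (|t| * (C₂ * (w.length : ℝ) * (s₁.card : ℝ) * (s₂.card : ℝ) * θ₁ ^ n * θₓ ^ n'))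
          + m * (Real.sinh (|t| * (C₂ * (w.length : ℝ) * (s₁.card : ℝ) * (s₂.card : ℝ) * θ₁ ^ n * θₓ ^ n'))
            / (C₂ * (w.length : ℝ) * (s₁.card : ℝ) * (s₂.card : ℝ) * θ₁ ^ n * θₓ ^ n')))
        * (fibreIntegral s₁ (fun U => old₁ U * Real.exp (t * loopDressing av j n x w U)) V
          * fibreIntegral s₂ (fun U => old₂ U * Real.exp (t * loopDressing av j n x w U)) V) :=
  fibreIntegral_union_exp_ratio_bounds hd (loopDressing av j n x w) hm₁ hm₂ hFm h0₁ h0₂ hC₁ hC₂ hI₁ hI₂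
    (B := 1) (fun _ => abs_loopAt_le_one _ _) t _ V
    (loopDressing_mixed_le_sep hW n hn x w hw hd hS hS' n' hn' hsep hI₁ hdom₁ hdom₂ V hV) hM

end ConsumerSep

end Literature.MathematicalPhysics.QuantumFieldTheory.Balaban1983to89.T4MomentMayerStep
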